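import Mathlib.RingTheory.Valuation.Integral
import Literature.FieldTheory.AlgClosed.PadicAlgClEquivComplex
import Literature.NumberTheory.EllipticCurves.HidaFamilyMembers
import Literature.NumberTheory.EllipticCurves.EisensteinNewformLevelRaisingDeligneSerreLiftProofs
import Literature.NumberTheory.EllipticCurves.EisensteinCongruence
import Literature.NumberTheory.EllipticCurves.CuspFormsGamma1EisensteinDivision
import Literature.NumberTheory.EllipticCurves.NewformsEigenpacketProofs
import Literature.NumberTheory.EllipticCurves.NewformsLiftProofs
import Literature.NumberTheory.EllipticCurves.NewformsMainLemmaProofs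
import Literature.NumberTheory.EllipticCurves.NewformsStrongMultiplicityOneProofs
import Literature.NumberTheory.EllipticCurves.NewformsOldHeckeStableProofs
import Literature.NumberTheory.EllipticCurves.NewformsPNewProofs
import Literature.NumberTheory.EllipticCurves.NewformsHeckeProofs
import Literature.NumberTheory.EllipticCurves.AtkinLehnerInvolutionsProofs
import Literature.NumberTheory.EllipticCurves.AtkinLehnerInvolutionsNewformProofs
import Literature.NumberTheory.EllipticCurves.EisensteinNewformLevelRaisingOrdinaryUnitRootProofs
import Literature.NumberTheory.EllipticCurves.NewformsCoeffFieldHolds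
import Literature.NumberTheory.EllipticCurves.PAdicLFunctionNeZeroProofs
import Literature.NumberTheory.EllipticCurves.LFunctionPrimeCoeff
import Literature.NumberTheory.DiophantineGeometry.ConductorExponentZeroProofs
import Literature.NumberTheory.DiophantineGeometry.ConductorFactorizationProofs
import HarnessLib

/-!
# Congruent ordinary newforms in higher weight: the classical (Deligne–Serre) half of
# `hida_exists_congruent_ordinary_newform` (proofs only)

Topic `Literature/NumberTheory/EllipticCurves`; namespaces
`Literature.NumberTheory.EllipticCurves.ModularForms` (modular forms) and
`Literature.NumberTheory.EllipticCurves` (elliptic curves).  THEOREMS ONLY (no definition, no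
named fact; D-0026).  A proofs-only companion of the named fact
`Literature.NumberTheory.EllipticCurves.hida_exists_congruent_ordinary_newform`
(`HidaFamilyMembers.lean`; Hida 1986 / Emerton–Pollack–Weston 2006, Thms. 2.1.2, 2.2.2: for
`E/ℚ` of conductor `N`, `p ≥ 5` good ordinary, `k > 2`, `k ≡ 2 (mod p - 1)`, a `p`-ordinary
newform `g ∈ S_k(Γ₀(N))` congruent to `f_E` modulo a prime above `p`).

The printed derivation of that fact has two layers:

1. (classical, Serre / Deligne–Serre 1974, 6.9–6.11) in weight `k` there is SOME eigenform of
   level `N` congruent to `f_E`: multiply `f_E` by the level-one Eisenstein series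
   `E_{k-2} ≡ 1 (mod p)` (von Staudt–Clausen; `(p - 1) ∣ (k - 2)`), observe that `f_E E_{k-2}` is
   an eigenvector of every Hecke operator MODULO `p` (the weight enters the `q`-expansion of `T_q`
   only through `q^{k-1} ≡ q (mod p)`), and lift it by the Deligne–Serre lemma; its eigenvalue
   packet away from `N` is then that of a newform of some level `M ∣ N` (Atkin–Lehner–Li), and
   `a_p ≡ a_p(E)` is a `p`-adic unit, so the newform is `p`-ordinary;
2. (`Λ`-adic, Hida 1986; Emerton–Pollack–Weston 2006, Thm. 2.2.2 (2)) the level is EXACTLY `N`: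
   the tame conductor is constant along the irreducible component of the ordinary `Λ`-adic Hecke
   algebra `𝕋_N^{new}` through `f_E` — equivalently, a level-raising theorem in weight `k` at the
   primes `q ∣ N` where `ρ̄_{E,p}` is less ramified.

This file PROVES layer 1 from the tree (everything needed is there: the full Atkin–Lehner–Li
theory on `Γ₀(N)`/`Γ₁(N)`, the `q`-expansion of `T_q`, `E_k ≡ 1 (mod p)`
(`DeligneSerre1974.eisenstein_qExpansion_congr_one`), the Deligne–Serre lifting lemma read through
`ι : ℚ̄_p ≃ ℂ` (`DeligneSerreLift.exists_eigenform_of_congruence`), the passage from an eigenpacket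
to a newform (`exists_isNewform1_of_eigenpacket`), and the modularity dictionary
`a_ℓ(f_E) = frobeniusTrace` (`LFunction_apply_prime_eq_frobeniusTrace`)):

* `Literature.NumberTheory.EllipticCurves.ModularForms.exists_isNewform0_dvd_level_congr` — for a
  newform `f ∈ S_{k₀}(Γ₀(N))`, `k₀ ≥ 2`, any prime `p`, any `ι : ℚ̄_p ≃ ℂ` and any even `w ≥ 3`
  with `(p - 1) ∣ w`: a newform `g ∈ S_{k₀+w}(Γ₀(M))`, `M ∣ N`, with
  `‖ι⁻¹ a_q(g) - ι⁻¹ a_q(f)‖ < 1` for every prime `q ∤ N` (no ordinarity needed);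
* `Literature.NumberTheory.EllipticCurves.exists_isNewform0_dvd_conductorNorm_congr_of_exists_isNewformOf`
  — granted the Modularity Theorem (`exists_isNewformOf`, the tree's named fact; BCDT 2001,
  Thm. A), the statement of `hida_exists_congruent_ordinary_newform` with "newform of level `N`"
  replaced by "newform of some level `M ∣ N`": `|ι a_p(g)|_p = 1` and
  `|ι a_ℓ(g) - a_ℓ(E)|_p < 1` for all primes `ℓ ∤ N p`;
* `Literature.NumberTheory.EllipticCurves.hasGoodReductionAtPrime_of_not_dvd_conductorNorm` —
  bookkeeping: `ℓ ∤ N_E` implies good reduction at `ℓ` (Silverman ATAEC IV.10.2(a), from the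
  tree's `conductorExponent_eq_zero_iff_holds`, `factorization_conductorNorm_holds`).

Layer 2 (exact level `N`), hence the named fact itself, is NOT proved here: it rests on Hida's
control theorem for the ordinary `Λ`-adic Hecke algebra and the theory of its new quotient
(Hida, Invent. Math. 85 (1986), §3; Hida, Ann. Sci. ÉNS 19 (1986); Emerton–Pollack–Weston 2006,
Thms. 2.1.2, 2.2.2; Hida, *Elementary Modular Iwasawa Theory* (2022), Thms. 4.1.24, 4.1.26, 4.1.29,
Cor. 4.1.30), absent from Mathlib and from the tree, and on the Modularity Theorem.  What the
`Λ`-adic theory hands over in weight `k` is a `p`-ORDINARY `p`-STABILISED NEW EIGENFORM of tame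
level `N`, i.e. an eigenform `F ∈ S_k(Γ₀(Np))` of the `T_q` (`q ∤ Np`) and of `U_p` with a unit
`U_p`-eigenvalue, new at the primes dividing `N`; the classical descent from such an `F` to the
newform `g ∈ S_k(Γ₀(N))` of the named fact ("`p`-stabilisation backwards", Hida EMI, proof of
Cor. 4.1.30 via Miyake Thm. 4.6.17) is also PROVED here, so that only the `Λ`-adic core remains:

* `Literature.NumberTheory.EllipticCurves.ModularForms.exists_isNewform0_mem_span_of_eigenpacket` —
  the `Γ₀`-version of "eigenform ⇒ newform", sharpened by strong multiplicity one: a non-zero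
  `T_q`-eigenform (`q ∤ L`) on `Γ₀(L)` is a combination of the old forms `[α_d]_k g`, `M d ∣ L`,
  from ONE newform `g` of level `M ∣ L` with the same eigenvalues (Atkin–Lehner basis of the tree:
  `linearIndependent_degeneracyMap0_newforms`, `span_range_degeneracyMap0_newforms`,
  `injective_heckeEigenvalue_newform_off_level`);
* `…heckeT_eq_smul_of_mem_span_of_dvd`, `…heckeT_heckeT_sub_add_eq_zero_of_mem_span_of_not_dvd`
  — `U_p` on these old forms: `U_p = a_p(g)` if `p ∣ M`, and `U_p² - a_p(g) U_p + p^{k-1} = 0` if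
  `p ∤ M` (`p ∥ L`; Diamond–Shurman Prop. 5.6.2);
* `…IsNewform0.coeff_sq_eq_of_exactly_dvd` — `a_p(g)² = p^{k-2}` for a newform of level `p M`,
  `p ∤ M` (Miyake Thm. 4.6.17 (2); Knapp Thm. 9.27, from the tree's Atkin–Lehner eigenvalue
  `λ(p) = -p^{1-k/2} a_p = ±1`);
* `…exists_isNewform0_of_ordinary_pStabilised` — for `p ∤ N`, `k > 2`, a non-zero eigenform
  `F ∈ S_k(Γ₀(Np))` of the `T_q` (`q ∤ Np`) and `U_p` with unit `U_p`-eigenvalue `u` comes from a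
  newform `g` of level `M ∣ N` with `u² - a_p(g) u + p^{k-1} = 0` and `|ι⁻¹ a_p(g)|_p = 1`;
* `…exists_isNewform0_level_of_ordinary_pStabilised_of_new` — if moreover `F` is new at every
  prime `q ∣ N`, then `M = N` (`eq_zero_of_mem_span_of_mem_pNew`: old forms from a level
  `M ∣ L/q` are `q`-old, and `q`-old `∩` `q`-new `= 0`, `disjoint_pOld_pNew`);
* `…exists_ordinary_pStabilised_of_isNewform0` — forwards: the `p`-stabilisation
  `F = f - (a_p - u) f(pτ) ∈ S_k(Γ₀(Np))` of a `p`-ordinary newform `f` of level `N`, `p ∤ N`,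
  `k ≥ 2` (`u` the unit root of `X² - a_p X + p^{k-1}`): `a₁(F) = 1`, `T_q F = a_q(f) F`
  (`q ∤ Np`), `U_p F = u F`, and `F` is new at every `q ∣ N` (`degeneracyMap0_mem_pNew`) — the
  INPUT of the `Λ`-adic step (Hida 1986, (1.9)).  So the missing `Λ`-adic core is exactly: "the
  `p`-ordinary `p`-stabilised newforms of tame level `N` in the weights `k ≡ k₀ (mod p - 1)`,
  `k ≥ 2`, congruent to a given one of weight `k₀`, exist" (Hida 1986, Thm. 1.2 with Cor. 1.3 and
  Cor. 1.6; Emerton–Pollack–Weston 2006, Thm. 2.2.2);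
* `Literature.NumberTheory.EllipticCurves.hida_exists_congruent_ordinary_newform_of_exists_isNewformOf_of_lambdaAdic`
  — the CONDITIONAL assembly: `exists_isNewformOf →` (that classical shadow of Hida 1986,
  Thm. 1.2 / Cor. 1.3 / Cor. 1.6, as an explicit hypothesis, not a fact of the tree) `→`
  `hida_exists_congruent_ordinary_newform`, proving that the two black boxes are all that is
  missing (no `_holds` is claimed).

## References

* P. Deligne, J.-P. Serre, *Formes modulaires de poids 1*, Ann. Sci. ÉNS (4) 7 (1974), 507–530,
  6.9–6.11. [DeligneSerreASENS1974]
* F. Diamond, J. Shurman, *A First Course in Modular Forms*, GTM 228 (2005), Prop. 5.5.2, Prop. 5.6.2, Prop. 5.8.5,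
  Thm. 5.8.2–5.8.3. [DiamondShurman2005]
* H. Hida, *Galois representations into `GL₂(ℤ_p[[X]])` attached to ordinary cusp forms*,
  Invent. Math. 85 (1986), 545–613. [Hida1986]
* H. Hida, *Elementary Modular Iwasawa Theory*, World Scientific (2022), §4.1, Cor. 4.1.30.
  [Hida2022EMI]
* T. Miyake, *Modular Forms*, Springer (1989), Thm. 4.6.17.
* A. W. Knapp, *Elliptic Curves*, Princeton (1992), Thm. 9.27. [Knapp1993]
* M. Emerton, R. Pollack, T. Weston, *Variation of Iwasawa invariants in Hida families*, Invent.
  Math. 163 (2006), 523–580, §2.1–2.2. [EmertonPollackWeston2005]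
* C. Breuil, B. Conrad, F. Diamond, R. Taylor, *On the modularity of elliptic curves over `ℚ`*,
  J. Amer. Math. Soc. 14 (2001), Thm. A. [BreuilConradDiamondTaylor2001]
-/

noncomputable section

open scoped MatrixGroups ModularForm
open CongruenceSubgroup UpperHalfPlane

namespace Literature.NumberTheory.EllipticCurves.ModularForms

/-! ### Norm bookkeeping in `ℚ̄_p` -/

section Norm

variable {p : ℕ} [Fact p.Prime]

/-- Chaining two congruences modulo `𝔪`. [folklore] -/
private theorem norm_sub_lt_one_trans {x y z : PadicAlgCl p} (h₁ : ‖x - y‖ < 1)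
    (h₂ : ‖y - z‖ < 1) : ‖x - z‖ < 1 := by
  have : x - z = (x - y) + (y - z) := by ring
  rw [this]
  exact (PadicAlgCl.isNonarchimedean p _ _).trans_lt (max_lt h₁ h₂)

/-- Ultrametric inequality for differences. [folklore] -/
private theorem norm_sub_le_max' (x y : PadicAlgCl p) : ‖x - y‖ ≤ max ‖x‖ ‖y‖ := by
  have h := PadicAlgCl.isNonarchimedean p x (-y)
  rwa [norm_neg, ← sub_eq_add_neg] at h

/-- An element congruent to an element of norm `1` has norm `1`. [folklore] -/
private theorem norm_eq_one_of_norm_sub_lt_one {x y : PadicAlgCl p} (hy : ‖y‖ = 1)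
    (h : ‖x - y‖ < 1) : ‖x‖ = 1 := by
  apply le_antisymm
  · have h1 : x = (x - y) + y := by ring
    rw [h1]
    exact (PadicAlgCl.isNonarchimedean p _ _).trans (max_le h.le hy.le)
  · by_contra hlt
    push Not at hlt
    have h1 : y = x - (x - y) := by ring
    have h2 : ‖y‖ < 1 := by
      rw [h1]
      have h3 := PadicAlgCl.isNonarchimedean p x (-(x - y))
      rw [norm_neg, ← sub_eq_add_neg] at h3
      exact h3.trans_lt (max_lt hlt h)
    rw [hy] at h2
    exact lt_irrefl _ h2

/-- **Algebraic integers of `ℚ̄_p` have norm at most one** (the valuation ring of `ℚ̄_p` is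
integrally closed and contains `ℤ`). [folklore] -/
private theorem norm_le_one_of_isIntegral {x : PadicAlgCl p} (hx : IsIntegral ℤ x) :
    ‖x‖ ≤ 1 := by
  have hv := Valuation.integer.integers (Valued.v (R := PadicAlgCl p))
  have hx' : IsIntegral (Valued.v (R := PadicAlgCl p)).integer x := hx.tower_top
  have h := (hv.isIntegral_iff_v_le_one).mp hx'
  rw [PadicAlgCl.valuation_def] at h
  exact_mod_cast h

/-- `‖p‖ < 1` in `ℚ̄_p`. [folklore] -/
private theorem norm_natCast_prime_lt_one : ‖(p : PadicAlgCl p)‖ < 1 := by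
  rw [← map_natCast (algebraMap ℚ_[p] (PadicAlgCl p)) p]
  change ‖((p : ℚ_[p]) : PadicAlgCl p)‖ < 1
  rw [PadicAlgCl.norm_extends]
  exact Padic.norm_p_lt_one

/-- An integer divisible by `p` has norm `< 1` in `ℚ̄_p`. [folklore] -/
private theorem norm_intCast_lt_one_of_dvd {z : ℤ} (hz : (p : ℤ) ∣ z) :
    ‖(z : PadicAlgCl p)‖ < 1 := by
  rw [← map_intCast (algebraMap ℚ_[p] (PadicAlgCl p)) z]
  change ‖((z : ℚ_[p]) : PadicAlgCl p)‖ < 1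
  rw [PadicAlgCl.norm_extends]
  exact Padic.norm_intCast_lt_one_iff.2 hz

/-- A rational number of `p`-adic valuation `< 1` (an element of `p ℤ_{(p)}`) has norm `< 1` in
`ℚ̄_p`. [folklore] -/
private theorem norm_ratCast_lt_one {r : ℚ} (hr : Rat.padicValuation p r < 1) :
    ‖(r : PadicAlgCl p)‖ < 1 := by
  have hp : p.Prime := Fact.out
  have hnum := (DeligneSerre1974.padicValuation_lt_one_iff_dvd_num r).mp hr
  have hden : ¬ (p : ℤ) ∣ (r.den : ℤ) := by
    intro h
    have h1 : p ∣ r.num.natAbs := Int.natCast_dvd.mp hnum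
    have h2 : p ∣ r.num.natAbs.gcd r.den := Nat.dvd_gcd h1 (Int.natCast_dvd_natCast.mp h)
    rw [r.reduced.gcd_eq_one] at h2
    exact hp.ne_one (Nat.dvd_one.mp h2)
  have hr' : (r : PadicAlgCl p) = (r.num : PadicAlgCl p) / (r.den : ℤ) := by
    rw [Int.cast_natCast]
    exact_mod_cast (Rat.num_div_den r).symm
  rw [hr', norm_div, DeligneSerreLift.norm_intCast_eq_one_of_not_dvd hden, div_one]
  exact norm_intCast_lt_one_of_dvd hnum

/-- A finite sum of elements of norm `< 1` has norm `< 1` (ultrametric inequality). [folklore] -/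
private theorem norm_sum_lt_one {α : Type*} (s : Finset α) (u : α → PadicAlgCl p)
    (h : ∀ a ∈ s, ‖u a‖ < 1) : ‖∑ a ∈ s, u a‖ < 1 := by
  rcases s.eq_empty_or_nonempty with rfl | hs
  · simp
  · obtain ⟨a, ha, hle⟩ := IsUltrametricDist.exists_norm_finsetSum_le_of_nonempty hs u
    exact hle.trans_lt (h a ha)

end Norm

/-! ### The classical half: a congruent newform of level dividing `N` in every admissible weight -/

section DeligneSerre

variable {p : ℕ} [Fact p.Prime]

set_option maxHeartbeats 1600000 in
/-- **Congruent newforms in higher weight (Deligne–Serre).**  Let `p` be a prime,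
`ι : ℚ̄_p ≃ ℂ`, `f ∈ S_{k₀}(Γ₀(N))` a newform of weight `k₀ ≥ 2`, and `w ≥ 3` an even integer
divisible by `p - 1`.  Then there are a divisor `M ∣ N` and a newform `g ∈ S_{k₀+w}(Γ₀(M))` with
`a_q(g) ≡ a_q(f)` modulo the maximal ideal of `𝒪_{ℚ̄_p}` (read through `ι⁻¹`) for every prime
`q ∤ N`.  Proof: `f · E_w ∈ S_{k₀+w}(Γ₀(N))` has `p`-integral coefficients congruent to those of
`f` (`E_w ≡ 1 (mod p)`, Deligne–Serre 1974, 6.9, von Staudt–Clausen) and is therefore an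
eigenvector MODULO `𝔪` of every `T_q` with eigenvalue `a_q(f)` (the weight enters the
`q`-expansion of `T_q` only through `q^{k-1}`, and `q^{k₀+w-1} ≡ q^{k₀-1} (mod p)` by Fermat, both
sides being `≡ 0` for `q = p` as `k₀ ≥ 2`); the Deligne–Serre lifting lemma (op. cit. 6.11) gives
a genuine eigenform of level `N`, weight `k₀ + w` and trivial character with congruent
eigenvalues, and its eigenvalue packet away from `N` is that of a newform of some level `M ∣ N`
(Atkin–Lehner–Li).  This is the classical part of the construction of the weight-`(k₀+w)` member
of the Hida family through `f`; the exact level `M = N` is NOT asserted here (it needs Hida's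
`Λ`-adic theory). [cite: DeligneSerreASENS1974, 6.9–6.11] [cite: DiamondShurman2005, Thm. 5.8.2–5.8.3] -/
theorem exists_isNewform0_dvd_level_congr (ι : PadicAlgCl p ≃+* ℂ) {N : ℕ} [NeZero N]
    {k₀ : ℤ} (hk₀ : 2 ≤ k₀) {f : CuspForm (Gamma0 N) k₀} (hf : IsNewform0 f)
    {w : ℕ} (hw3 : 3 ≤ w) (hwe : Even w) (hpw : (p - 1) ∣ w) :
    ∃ (M : ℕ) (_ : NeZero M) (_ : M ∣ N) (g : CuspForm (Gamma0 M) (k₀ + w)),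
      IsNewform0 g ∧
      ∀ q : ℕ, q.Prime → ¬ q ∣ N →
        ‖ι.symm ((qExpansion 1 ⇑g).coeff q) - ι.symm ((qExpansion 1 ⇑f).coeff q)‖ < 1 := by
  classical
  have hp : p.Prime := Fact.out
  have hK1 : (1 : ℤ) ≤ k₀ + w := by omega
  have h1N := HeckeTGamma1.one_mem_strictPeriods_Gamma1 N
  -- ### the Eisenstein series `E_w ≡ 1 (mod p)` and the form `x = f · E_w ∈ S_{k₀+w}(N, 𝟙)`
  set E := ModularForm.E hw3 with hEdef
  obtain ⟨hE0, hEm⟩ := DeligneSerre1974.eisenstein_qExpansion_congr_one (ℓ := p) hw3 hwe hpw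
  set f₁ : CuspForm (Gamma1 N) k₀ := liftToGamma1 N k₀ f with hf₁def
  have hf₁ : ∀ n, cuspCoeff f₁ n = (qExpansion 1 ⇑f).coeff n := fun n ↦ by
    change (qExpansion 1 ⇑(liftToGamma1 N k₀ f)).coeff n = _
    rw [coe_liftToGamma1_holds N k₀ f]
  let x : CuspForm (Gamma1 N) (k₀ + w) := f₁.mulModularForm (ofLevelOne (Gamma1 N) E)
  have hxq : qExpansion 1 ⇑x = qExpansion 1 ⇑f₁ * qExpansion 1 ⇑E :=
    qExpansion_mulModularForm_ofLevelOne E f₁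
  have hxmul : ∀ m, cuspCoeff x m = ∑ ij ∈ Finset.HasAntidiagonal.antidiagonal m,
      cuspCoeff f₁ ij.1 * (qExpansion 1 ⇑E).coeff ij.2 := fun m ↦ by
    change (qExpansion 1 ⇑x).coeff m = _
    rw [hxq, PowerSeries.coeff_mul]
    rfl
  -- ### norms: `a_n(f)` integral, `e_j ∈ 𝔪` for `j ≠ 0`
  set A : ℕ → PadicAlgCl p := fun n ↦ ι.symm ((qExpansion 1 ⇑f).coeff n) with hA
  have hAint : ∀ n, ‖A n‖ ≤ 1 := fun n ↦
    norm_le_one_of_isIntegral ((IsNewform0.isIntegral_coeff_holds hf n).map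
      (ι.symm : ℂ →+* PadicAlgCl p).toIntAlgHom)
  have hEnorm : ∀ j, j ≠ 0 → ‖ι.symm ((qExpansion 1 ⇑E).coeff j)‖ < 1 := by
    intro j hj
    obtain ⟨r, hr, hrj⟩ := hEm j hj
    rw [hrj, map_ratCast]
    exact norm_ratCast_lt_one hr
  -- ### `x ≡ f`: `‖ι⁻¹ a_m(x) - ι⁻¹ a_m(f)‖ < 1`, `‖ι⁻¹ a_m(x)‖ ≤ 1`, `a_1(x) ≡ 1`
  have hxf : ∀ m, ‖ι.symm (cuspCoeff x m) - A m‖ < 1 := by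
    intro m
    have hmem : (m, 0) ∈ Finset.HasAntidiagonal.antidiagonal m := by simp
    rw [hxmul, ← Finset.add_sum_erase _ _ hmem, hE0, mul_one, hf₁, map_add, hA,
      add_sub_cancel_left, map_sum]
    refine norm_sum_lt_one _ _ fun ij hij ↦ ?_
    obtain ⟨hne, hij'⟩ := Finset.mem_erase.mp hij
    have hj : ij.2 ≠ 0 := by
      intro h
      apply hne
      have := Finset.HasAntidiagonal.mem_antidiagonal.mp hij'
      rw [h, add_zero] at this
      exact Prod.ext this h
    rw [map_mul, hf₁, norm_mul]
    exact mul_lt_one_of_nonneg_of_lt_one_right (hAint _) (norm_nonneg _) (hEnorm _ hj)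
  have hxint : ∀ m, ‖ι.symm (cuspCoeff x m)‖ ≤ 1 := fun m ↦ by
    have h1 : ι.symm (cuspCoeff x m) = (ι.symm (cuspCoeff x m) - A m) + A m := by ring
    rw [h1]
    exact (PadicAlgCl.isNonarchimedean p _ _).trans (max_le (hxf m).le (hAint m))
  have hA1 : A 1 = 1 := by
    rw [hA]
    change ι.symm ((qExpansion 1 ⇑f).coeff 1) = 1
    rw [show (qExpansion 1 ⇑f).coeff 1 = 1 from hf.2.2, map_one]
  have hx1 : ‖ι.symm (cuspCoeff x 1)‖ = 1 :=
    norm_eq_one_of_norm_sub_lt_one (y := A 1) (by rw [hA1, norm_one]) (hxf 1)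
  -- ### `x ∈ S_{k₀+w}(N, 𝟙)`
  have hxW : x ∈ nebentypusSubspace N (k₀ + w) 1 := by
    rw [mem_nebentypusSubspace_iff_diamondOp]
    intro d
    change diamondOp N (k₀ + (w : ℤ)) d (f₁.mulModularForm (ofLevelOne (Gamma1 N) E)) = _
    rw [diamondOp_mulModularForm_ofLevelOne E (d : ZMod N) f₁, hf₁def,
      diamondOp_liftToGamma1 N k₀ (d : ZMod N) f, MulChar.one_apply_coe, one_smul]
  have hxdiam : ∀ d : (ZMod N)ˣ, diamondOp N (k₀ + w) (d : ZMod N) x = x := fun d ↦ by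
    have h := (mem_nebentypusSubspace_iff_diamondOp.mp hxW) d
    rwa [MulChar.one_apply_coe, one_smul] at h
  -- ### the Hecke relations of `f` (Diamond–Shurman Prop. 5.8.5) read in `ℚ̄_p`
  -- exponents: `k₀ - 1 = e₀`, `k₀ + w - 1 = e₀ + w`
  obtain ⟨e₀, he₀⟩ : ∃ e₀ : ℕ, k₀ - 1 = (e₀ : ℤ) := ⟨(k₀ - 1).toNat, by omega⟩
  have he₀1 : 1 ≤ e₀ := by omega
  have hzpow₀ : ∀ q : ℕ, (q : ℂ) ^ (k₀ - 1) = ((q ^ e₀ : ℕ) : ℂ) := fun q ↦ by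
    rw [he₀, zpow_natCast, Nat.cast_pow]
  have hzpow : ∀ q : ℕ, (q : ℂ) ^ (k₀ + (w : ℤ) - 1) = ((q ^ (e₀ + w) : ℕ) : ℂ) := fun q ↦ by
    rw [show k₀ + (w : ℤ) - 1 = ((e₀ + w : ℕ) : ℤ) by push_cast; omega, zpow_natCast,
      Nat.cast_pow]
  -- `p ∣ q^{e₀+w} - q^{e₀}` for every prime `q`
  have hdvd : ∀ q : ℕ, q.Prime → (p : ℤ) ∣ ((q ^ (e₀ + w) : ℕ) : ℤ) - ((q ^ e₀ : ℕ) : ℤ) := by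
    intro q hq
    have hfac : ((q ^ (e₀ + w) : ℕ) : ℤ) - ((q ^ e₀ : ℕ) : ℤ) =
        (q : ℤ) ^ e₀ * ((q : ℤ) ^ w - 1) := by push_cast; ring
    rw [hfac]
    by_cases hqp : q = p
    · subst hqp
      exact Dvd.dvd.mul_right (dvd_pow_self (q : ℤ) (by omega)) _
    · apply Dvd.dvd.mul_left
      have hcop : IsCoprime (q : ℤ) p := by
        rw [Nat.isCoprime_iff_coprime]
        exact (Nat.coprime_primes hq hp).2 hqp
      obtain ⟨c, hc⟩ := hpw
      have h1 : (q : ℤ) ^ (p - 1) ≡ 1 [ZMOD p] := Int.ModEq.pow_card_sub_one_eq_one hp hcop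
      have h2 : (q : ℤ) ^ w ≡ 1 [ZMOD p] := by
        rw [hc, pow_mul]
        simpa using h1.pow c
      exact (Int.ModEq.dvd h2.symm)
  have hpowdiff : ∀ q : ℕ, q.Prime →
      ‖ι.symm (((q ^ (e₀ + w) : ℕ) : ℂ)) - ι.symm (((q ^ e₀ : ℕ) : ℂ))‖ < 1 := by
    intro q hq
    rw [map_natCast, map_natCast]
    have h := norm_intCast_lt_one_of_dvd (hdvd q hq)
    push_cast at h ⊢
    exact h
  have hpownorm : ∀ q : ℕ, ‖ι.symm (((q ^ (e₀ + w) : ℕ) : ℂ))‖ ≤ 1 := fun q ↦ by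
    rw [map_natCast, ← Int.cast_natCast]
    exact DeligneSerreLift.norm_intCast_le_one _
  -- ### `(B)` `x` is an eigenvector modulo `𝔪` of every `T_q`, with eigenvalue `a_q(f)`
  have hcongT : ∀ (q : ℕ) (hq : q.Prime) (n : ℕ),
      ‖ι.symm (cuspCoeff ((haveI : NeZero q := ⟨hq.ne_zero⟩;
          heckeT (Gamma1 N) (k₀ + w) q) x) n) - A q * ι.symm (cuspCoeff x n)‖ < 1 := by
    intro q hq n
    haveI : NeZero q := ⟨hq.ne_zero⟩
    -- `T_q` on `x` (weight `k₀ + w`)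
    have hTx := cuspCoeff_heckeT_gamma1 x q hq n
    -- the relation `a_{qn}(f) = a_q a_n - …` (weight `k₀`)
    have hrel := IsNewform0.coeff_prime_mul hf hq n
    set D : ℕ → PadicAlgCl p := fun m ↦ ι.symm (cuspCoeff x m) - A m with hD
    have hDlt : ∀ m, ‖D m‖ < 1 := hxf
    have hxD : ∀ m, ι.symm (cuspCoeff x m) = A m + D m := fun m ↦ by rw [hD]; ring
    by_cases hqN : q ∣ N
    · rw [if_pos hqN, add_zero] at hTx
      rw [if_pos hqN, sub_zero] at hrel
      -- `ι⁻¹ a_n(T_q x) - A q ι⁻¹ a_n(x) = D(qn) - A q D n`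
      have e1 : ι.symm (cuspCoeff (heckeT (Gamma1 N) (k₀ + ↑w) q x) n) -
          A q * ι.symm (cuspCoeff x n) = D (q * n) - A q * D n := by
        rw [hTx, hxD, hxD n]
        have : A (q * n) = A q * A n := by
          simp only [hA]
          rw [hrel, map_mul]
        rw [this]
        ring
      rw [e1]
      refine (norm_sub_le_max' _ _).trans_lt (max_lt (hDlt _) ?_)
      rw [norm_mul]
      exact mul_lt_one_of_nonneg_of_lt_one_right (hAint q) (norm_nonneg _) (hDlt n)
    · rw [if_neg hqN] at hTx hrel
      obtain ⟨d, hd⟩ := (ZMod.isUnit_prime_iff_not_dvd hq).mpr hqN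
      have hdiag : diamondOp N (k₀ + w) (q : ZMod N) x = x := by rw [← hd]; exact hxdiam d
      rw [hdiag, hzpow q] at hTx
      rw [hzpow₀ q] at hrel
      by_cases hqn : q ∣ n
      · rw [if_pos hqn] at hTx hrel
        have e1 : ι.symm (cuspCoeff (heckeT (Gamma1 N) (k₀ + ↑w) q x) n) -
            A q * ι.symm (cuspCoeff x n) =
            D (q * n) - A q * D n +
              (ι.symm (((q ^ (e₀ + w) : ℕ) : ℂ)) * D (n / q) +
                (ι.symm (((q ^ (e₀ + w) : ℕ) : ℂ)) - ι.symm (((q ^ e₀ : ℕ) : ℂ))) *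
                  A (n / q)) := by
          rw [hTx, map_add, map_mul, hxD, hxD n, hxD (n / q)]
          have : A (q * n) = A q * A n - ι.symm (((q ^ e₀ : ℕ) : ℂ)) * A (n / q) := by
            simp only [hA]
            rw [hrel, map_sub, map_mul, map_mul]
          rw [this]
          ring
        rw [e1]
        refine (PadicAlgCl.isNonarchimedean p _ _).trans_lt (max_lt ?_ ?_)
        · refine (norm_sub_le_max' _ _).trans_lt (max_lt (hDlt _) ?_)
          rw [norm_mul]
          exact mul_lt_one_of_nonneg_of_lt_one_right (hAint q) (norm_nonneg _) (hDlt n)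
        · refine (PadicAlgCl.isNonarchimedean p _ _).trans_lt (max_lt ?_ ?_)
          · rw [norm_mul]
            exact mul_lt_one_of_nonneg_of_lt_one_right (hpownorm q) (norm_nonneg _) (hDlt _)
          · rw [norm_mul]
            exact mul_lt_one_of_nonneg_of_lt_one_left (norm_nonneg _) (hpowdiff q hq)
              (hAint _)
      · rw [if_neg hqn, mul_zero, add_zero] at hTx
        rw [if_neg hqn, mul_zero, sub_zero] at hrel
        have e1 : ι.symm (cuspCoeff (heckeT (Gamma1 N) (k₀ + ↑w) q x) n) -
            A q * ι.symm (cuspCoeff x n) = D (q * n) - A q * D n := by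
          rw [hTx, hxD, hxD n]
          have : A (q * n) = A q * A n := by
            simp only [hA]
            rw [hrel, map_mul]
          rw [this]
          ring
        rw [e1]
        refine (norm_sub_le_max' _ _).trans_lt (max_lt (hDlt _) ?_)
        rw [norm_mul]
        exact mul_lt_one_of_nonneg_of_lt_one_right (hAint q) (norm_nonneg _) (hDlt n)
  -- ### `(C)` Deligne–Serre lifting inside `S_{k₀+w}(N, 𝟙)`
  let TL : ℕ → Module.End ℂ (CuspForm (Gamma1 N) (k₀ + w)) := fun q ↦
    if hq : q = 0 then 0 else (haveI : NeZero q := ⟨hq⟩; heckeT (Gamma1 N) (k₀ + w) q)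
  have hTL : ∀ (q : ℕ) (hq : q ≠ 0),
      TL q = (haveI : NeZero q := ⟨hq⟩; heckeT (Gamma1 N) (k₀ + w) q) := fun q hq ↦ dif_neg hq
  let 𝒯 : Set (Module.End ℂ (CuspForm (Gamma1 N) (k₀ + w))) :=
    {T | ∃ q : ℕ, q.Prime ∧ T = TL q}
  have hcomm : ∀ S ∈ 𝒯, ∀ T ∈ 𝒯, Commute S T := by
    rintro S ⟨q, hq, rfl⟩ T ⟨q', hq', rfl⟩
    rw [hTL q hq.ne_zero, hTL q' hq'.ne_zero]
    haveI : NeZero q := ⟨hq.ne_zero⟩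
    haveI : NeZero q' := ⟨hq'.ne_zero⟩
    exact heckeT_comm_holds N (k₀ + w) q q'
  have hdiam : ∀ T ∈ 𝒯, ∀ d : (ZMod N)ˣ,
      Commute T (diamondOp N (k₀ + w) (d : ZMod N)) := by
    rintro T ⟨q, hq, rfl⟩ d
    rw [hTL q hq.ne_zero]
    haveI : NeZero q := ⟨hq.ne_zero⟩
    exact heckeT_diamondOp_comm_holds N (k₀ + w) q (d : ZMod N)
  have hΛ : ∀ T ∈ 𝒯, ∀ y ∈ integralLattice1 N (k₀ + w), T y ∈ integralLattice1 N (k₀ + w) := by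
    rintro T ⟨q, hq, rfl⟩ y hy
    rw [hTL q hq.ne_zero]
    haveI : NeZero q := ⟨hq.ne_zero⟩
    exact heckeT_mem_integralLattice1 hK1 hy q hq
  -- the targets: any admissible congruence class (they are unique modulo `𝔪`)
  let P : Module.End ℂ (CuspForm (Gamma1 N) (k₀ + w)) → PadicAlgCl p → Prop := fun T c ↦
    ‖c‖ ≤ 1 ∧ ∀ n, ‖ι.symm (cuspCoeff (T x) n) - c * ι.symm (cuspCoeff x n)‖ < 1
  let a : Module.End ℂ (CuspForm (Gamma1 N) (k₀ + w)) → PadicAlgCl p := fun T ↦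
    if h : ∃ c, P T c then h.choose else 0
  have haP : ∀ T c, P T c → P T (a T) := by
    intro T c hc
    have h : ∃ c, P T c := ⟨c, hc⟩
    simp only [a, dif_pos h]
    exact h.choose_spec
  have hPuniq : ∀ T c₁ c₂, P T c₁ → P T c₂ → ‖c₁ - c₂‖ < 1 := by
    intro T c₁ c₂ h₁ h₂
    have h := norm_sub_lt_one_trans (by rw [← norm_neg, neg_sub]; exact h₁.2 1) (h₂.2 1)
    rw [← sub_mul, norm_mul, hx1, mul_one] at h
    exact h
  have hPT : ∀ (q : ℕ) (hq : q.Prime), P (TL q) (A q) := by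
    intro q hq
    refine ⟨hAint q, fun n ↦ ?_⟩
    rw [hTL q hq.ne_zero]
    exact hcongT q hq n
  have ha : ∀ T ∈ 𝒯, ‖a T‖ ≤ 1 := by
    intro T hT
    by_cases h : ∃ c, P T c
    · exact (haP T _ h.choose_spec).1
    · simp only [a, dif_neg h, norm_zero]; exact zero_le_one
  have hcongr : ∀ T ∈ 𝒯, ∀ n,
      ‖ι.symm (cuspCoeff (T x) n) - a T * ι.symm (cuspCoeff x n)‖ < 1 := by
    rintro T ⟨q, hq, rfl⟩ n
    exact (haP _ _ (hPT q hq)).2 n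
  have hm : ¬ p ∣ 1 := hp.not_dvd_one
  have hχm : (1 : DirichletCharacter ℂ N) ^ 1 = 1 := pow_one 1
  obtain ⟨g₁, a', hg₁0, hg₁χ, hTg⟩ := DeligneSerreLift.exists_eigenform_of_congruence ι hK1 hm hχm
    𝒯 hcomm hdiam hΛ a ha hxW hxint hx1 hcongr
  -- eigenvalues of `g₁`
  have hmemT : ∀ (q : ℕ), q.Prime → TL q ∈ 𝒯 := fun q hq ↦ ⟨q, hq, rfl⟩
  have ha'T : ∀ (q : ℕ), q.Prime → ‖a' (TL q) - A q‖ < 1 := by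
    intro q hq
    have h1 := (hTg _ (hmemT q hq)).2.1
    have h2 := hPuniq _ _ _ (haP _ _ (hPT q hq)) (hPT q hq)
    exact norm_sub_lt_one_trans h1 h2
  have hT : ∀ (q : ℕ) (hq : q.Prime), ¬ q ∣ N →
      (haveI : NeZero q := ⟨hq.ne_zero⟩; heckeT (Gamma1 N) (k₀ + w) q) g₁ =
        ι (a' (TL q)) • g₁ := by
    intro q hq _
    rw [← hTL q hq.ne_zero]
    exact (hTg _ (hmemT q hq)).2.2
  -- ### `(D)` the newform behind `g₁` (Atkin–Lehner–Li), on `Γ₀`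
  obtain ⟨M, _, hMN, g₀, hg₀new, hg₀q, hg₀χ⟩ :=
    exists_isNewform1_of_eigenpacket hg₁0 hg₁χ (a := fun q ↦ ι (a' (TL q))) hT
  have hneb : nebentypus g₀ = 1 := by
    apply DirichletCharacter.changeLevel_injective hMN
    rw [hg₀χ, map_one]
  have hg₀diam : ∀ d : ZMod M, IsUnit d → diamondOp M (k₀ + w) d g₀ = g₀ := by
    intro d hd
    obtain ⟨u, rfl⟩ := hd
    have h := (mem_nebentypusSubspace_iff_diamondOp.mp
      (IsNewform1.mem_nebentypusSubspace_nebentypus_holds hg₀new)) u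
    rwa [hneb, MulChar.one_apply_coe, one_smul] at h
  obtain ⟨g, hg⟩ := exists_liftToGamma1_eq_of_forall_diamondOp_eq (k₀ + w) g₀ hg₀diam
  have hgnew : IsNewform0 g := by
    rw [← isNewform1_liftToGamma1_iff_holds (N := M) (k := k₀ + w) g, hg]
    exact hg₀new
  refine ⟨M, inferInstance, hMN, g, hgnew, fun q hq hqN ↦ ?_⟩
  have hcoeff : (qExpansion 1 ⇑g).coeff q = cuspCoeff g₀ q := by
    rw [← hg]
    change _ = (qExpansion 1 ⇑(liftToGamma1 M (k₀ + w) g)).coeff q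
    rw [coe_liftToGamma1_holds M (k₀ + w) g]
  rw [hcoeff, hg₀q q hq hqN, RingEquiv.symm_apply_apply]
  exact ha'T q hq

end DeligneSerre

/-! ### The newform behind an eigenform on `Γ₀(L)` (Atkin–Lehner basis) -/

section Eigenpacket

variable {L : ℕ} [NeZero L] {k : ℤ}

omit [NeZero L] in
/-- `ι_d` only depends on the value of `d` (the divisibility proof is irrelevant). [folklore] -/
theorem iota_congr {M d d' : ℕ} [NeZero M] [NeZero d] [NeZero d'] (hd : d = d')
    (h : M * d ∣ L) (h' : M * d' ∣ L) (g : CuspForm (Gamma0 M) k) :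
    iota M L d k h g = iota M L d' k h' g := by
  subst hd
  rfl

set_option maxHeartbeats 800000 in
/-- **The newform behind an eigenform on `Γ₀(L)`, with the old forms it is made of.**  Let
`F ∈ S_k(Γ₀(L))`, `F ≠ 0`, be an eigenvector of the Hecke operators `T_q` for the primes `q ∤ L`,
`T_q F = a_q F`.  Then there are a divisor `M ∣ L` and a newform `g ∈ S_k(Γ₀(M))` with
`a_q(g) = a_q` for every prime `q ∤ L`, and `F` is a linear combination of the old forms
`[α_d]_k g`, `M d ∣ L` (Atkin–Lehner 1970, Thms. 4–5; Diamond–Shurman Thm. 5.8.3: the forms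
`[α_d]_k f`, `f` a newform of level `M`, `M d ∣ L`, form a basis of `S_k(Γ₀(L))` of simultaneous
`T_q`-eigenvectors with the eigenvalues of `f` (`linearIndependent_degeneracyMap0_newforms`,
`span_range_degeneracyMap0_newforms`), and distinct `(M, f)` have distinct eigenvalue packets off
`L` by strong multiplicity one (`injective_heckeEigenvalue_newform_off_level`); so all basis
vectors with a non-zero coordinate in `F` share the packet of `F` and come from ONE newform `g`).
The `Γ₀`-analogue, sharpened by strong multiplicity one, of `exists_isNewform1_of_eigenpacket`.
[cite: DiamondShurman2005, Thm. 5.8.3] [cite: AtkinLehner1970, Thm. 4 and Thm. 5] -/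
theorem exists_isNewform0_mem_span_of_eigenpacket {F : CuspForm (Gamma0 L) k} (hF0 : F ≠ 0)
    {a : ℕ → ℂ}
    (hT : ∀ (q : ℕ) (hq : q.Prime), ¬ q ∣ L →
      (haveI : NeZero q := ⟨hq.ne_zero⟩; heckeT (Gamma0 L) k q F) = a q • F) :
    ∃ (M : ℕ) (_ : NeZero M) (_ : M ∣ L) (g : CuspForm (Gamma0 M) k), IsNewform0 g ∧
      (∀ q : ℕ, q.Prime → ¬ q ∣ L → (qExpansion 1 ⇑g).coeff q = a q) ∧
      F ∈ Submodule.span ℂ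
        {v | ∃ (d : ℕ) (_ : NeZero d), M * d ∣ L ∧ v = degeneracyMap0 M L d k g} := by
  classical
  -- ### the Atkin–Lehner basis `v t = [α_d]_k f`, `t = ((M, f), d)`
  let I : Type := Σ j : (Σ y : {y : AtkinLehnerIndex L // y.1.2 = 1}, ↥(newforms0 y.1.1.1 k)),
    {x : AtkinLehnerIndex L // x.1.1 = j.1.1.1.1}
  let v : I → CuspForm (Gamma0 L) k := fun t ↦ degeneracyMap0 t.1.1.1.1.1 L t.2.1.1.2 k t.1.2.1
  have hli : LinearIndependent ℂ v := linearIndependent_degeneracyMap0_newforms L k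
  have hsp : ⊤ ≤ Submodule.span ℂ (Set.range v) := (span_range_degeneracyMap0_newforms L k).ge
  let B : Module.Basis I ℂ (CuspForm (Gamma0 L) k) := Module.Basis.mk hli hsp
  have hBv : ⇑B = v := Module.Basis.coe_mk hli hsp
  have hnew : ∀ t : I, IsNewform0 t.1.2.1 := fun t ↦ t.1.2.2
  -- the eigenvalue of `T_q` on `v t` is `a_q(f_t)`
  let e : ℕ → I → ℂ := fun q t ↦ (qExpansion 1 ⇑(t.1.2.1)).coeff q
  have hTv : ∀ (q : ℕ) (hq : q.Prime), ¬ q ∣ L → ∀ t : I,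
      (haveI : NeZero q := ⟨hq.ne_zero⟩; heckeT (Gamma0 L) k q (v t)) = e q t • v t := by
    intro q hq hqL t
    haveI : NeZero q := ⟨hq.ne_zero⟩
    change heckeT (Gamma0 L) k q (degeneracyMap0 _ L _ k _) = _
    rw [heckeT_degeneracyMap0 (mul_dvd_of_atkinLehnerIndex_fst_eq t.2) hq hqL,
      IsNewform0.heckeT_eq_coeff_smul (hnew t) hq, map_smul]
  -- ### coordinates of `F`; `a_q(f_t) = a_q` whenever the coordinate `c t` is non-zero
  set c : I →₀ ℂ := B.repr F with hc
  have hFc : F = Finsupp.linearCombination ℂ v c := by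
    rw [hc, ← hBv, B.linearCombination_repr]
  have hkey : ∀ (q : ℕ) (hq : q.Prime), ¬ q ∣ L → ∀ t : I, c t ≠ 0 → e q t = a q := by
    intro q hq hqL t ht
    haveI : NeZero q := ⟨hq.ne_zero⟩
    let c' : I →₀ ℂ := Finsupp.onFinset c.support (fun s ↦ e q s * c s) fun s hs ↦ by
      rw [Finsupp.mem_support_iff]
      exact right_ne_zero_of_mul hs
    have h1 : heckeT (Gamma0 L) k q F = Finsupp.linearCombination ℂ v c' := by
      rw [Finsupp.linearCombination_onFinset, hFc, Finsupp.linearCombination_apply, Finsupp.sum,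
        map_sum]
      refine Finset.sum_congr rfl fun s _ ↦ ?_
      rw [map_smul, hTv q hq hqL s, smul_smul, mul_comm]
    have h2 : a q • F = Finsupp.linearCombination ℂ v (a q • c) := by
      rw [map_smul, ← hFc]
    have h3 : c' = a q • c := hli (h1.symm.trans ((hT q hq hqL).trans h2))
    have h4 := congrArg (fun l : I →₀ ℂ ↦ l t) h3
    simp only [c', Finsupp.onFinset_apply, Finsupp.smul_apply, smul_eq_mul] at h4
    exact mul_right_cancel₀ ht h4
  -- ### a non-zero coordinate `t₀`; the newform `g = f_{t₀}`
  have hc0 : c ≠ 0 := fun h0 ↦ hF0 (by rw [hFc, h0, map_zero])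
  obtain ⟨t₀, ht₀⟩ : ∃ t₀, c t₀ ≠ 0 := by
    by_contra h
    push Not at h
    exact hc0 (Finsupp.ext h)
  set M : ℕ := t₀.1.1.1.1.1 with hM
  set g : CuspForm (Gamma0 M) k := t₀.1.2.1 with hg
  have hgnew : IsNewform0 g := hnew t₀
  have hML : M ∣ L := (dvd_mul_right _ _).trans t₀.1.1.1.2
  have hga : ∀ q : ℕ, q.Prime → ¬ q ∣ L → (qExpansion 1 ⇑g).coeff q = a q :=
    fun q hq hqL ↦ hkey q hq hqL t₀ ht₀
  -- ### every index with a non-zero coordinate has first component `t₀.1` (strong multiplicity one)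
  have hfst : ∀ t : I, c t ≠ 0 → t.1 = t₀.1 := by
    intro t ht
    apply injective_heckeEigenvalue_newform_off_level L k
    funext q
    obtain ⟨hq, hqL⟩ := q.2
    change heckeEigenvalue t.1.2.1 q.1 = heckeEigenvalue t₀.1.2.1 q.1
    rw [heckeEigenvalue_eq_coeff_of_isNormalized (hnew t).2.2 hq ((hnew t).2.1 q.1 hq),
      heckeEigenvalue_eq_coeff_of_isNormalized (hnew t₀).2.2 hq ((hnew t₀).2.1 q.1 hq)]
    exact (hkey q.1 hq hqL t ht).trans (hkey q.1 hq hqL t₀ ht₀).symm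
  -- ### hence `F` is a combination of the `[α_d]_k g`
  refine ⟨M, inferInstance, hML, g, hgnew, hga, ?_⟩
  rw [hFc, Finsupp.linearCombination_apply, Finsupp.sum]
  refine Submodule.sum_mem _ fun t ht ↦ Submodule.smul_mem _ _ (Submodule.subset_span ?_)
  have ht' : c t ≠ 0 := Finsupp.mem_support_iff.mp ht
  obtain ⟨j, x⟩ := t
  have hj : j = t₀.1 := hfst ⟨j, x⟩ ht'
  subst hj
  exact ⟨x.1.1.2, inferInstance, mul_dvd_of_atkinLehnerIndex_fst_eq x, rfl⟩

end Eigenpacket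

/-! ### `U_p` on the old forms coming from one newform (Diamond–Shurman Prop. 5.6.2) -/

section UpRelations

variable {L : ℕ} [NeZero L] {k : ℤ} {p : ℕ} [Fact p.Prime]

/-- **`U_p` acts by `a_p(g)` on the old forms from a `p`-new level.**  Let `p ∣ M`, `p² ∤ L` and
`g ∈ S_k(Γ₀(M))` a newform; then `U_p v = a_p(g) v` for every `v` in the span of the
`[α_d]_k g`, `M d ∣ L` (all such `d` are prime to `p`, and `U_p [α_d]_k = [α_d]_k U_p` for
`p ∤ d` when `p` divides both levels, Diamond–Shurman Prop. 5.6.2; `U_p g = a_p(g) g`,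
Atkin–Lehner 1970, Thm. 3). [cite: DiamondShurman2005, Prop. 5.6.2] -/
theorem heckeT_eq_smul_of_mem_span_of_dvd {M : ℕ} [NeZero M] (hpM : p ∣ M) (hp2 : ¬ p ^ 2 ∣ L)
    {g : CuspForm (Gamma0 M) k} (hg : IsNewform0 g) {v : CuspForm (Gamma0 L) k}
    (hv : v ∈ Submodule.span ℂ
      {v | ∃ (d : ℕ) (_ : NeZero d), M * d ∣ L ∧ v = degeneracyMap0 M L d k g}) :
    heckeT (Gamma0 L) k p v = (qExpansion 1 ⇑g).coeff p • v := by
  have hp : p.Prime := Fact.out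
  have hpL : p ∣ L ∨ True := Or.inr trivial
  -- the set of generators lies in the eigenspace, a submodule
  suffices h : Submodule.span ℂ
      {v | ∃ (d : ℕ) (_ : NeZero d), M * d ∣ L ∧ v = degeneracyMap0 M L d k g} ≤
      LinearMap.ker (heckeT (Gamma0 L) k p - (qExpansion 1 ⇑g).coeff p • LinearMap.id) by
    have := h hv
    rwa [LinearMap.mem_ker, LinearMap.sub_apply, LinearMap.smul_apply, LinearMap.id_apply,
      sub_eq_zero] at this
  refine Submodule.span_le.mpr ?_
  rintro _ ⟨d, _, hMd, rfl⟩
  rw [SetLike.mem_coe, LinearMap.mem_ker, LinearMap.sub_apply, LinearMap.smul_apply,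
    LinearMap.id_apply, sub_eq_zero]
  have hpd : ¬ p ∣ d := by
    rintro ⟨d', rfl⟩
    obtain ⟨M', rfl⟩ := hpM
    exact hp2 ((show p ^ 2 ∣ p * M' * (p * d') from ⟨M' * d', by ring⟩).trans hMd)
  have hpL' : p ∣ L := hpM.trans ((dvd_mul_right M d).trans hMd)
  rw [degeneracyMap0_eq_smul_iota M L d k hMd, map_smul,
    heckeT_iota_of_not_dvd hMd hp hpd ⟨fun _ ↦ hpL', fun _ ↦ hpM⟩,
    IsNewform0.heckeT_eq_coeff_smul hg hp, map_smul, smul_comm]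

/-- **The quadratic `U_p`-relation on the old forms from a level prime to `p`.**  Let `p ∤ M`,
`p ∣ L`, `p² ∤ L` and `g ∈ S_k(Γ₀(M))` a newform; then
`U_p² v - a_p(g) U_p v + p^{k-1} v = 0` for every `v` in the span of the `[α_d]_k g`, `M d ∣ L`:
on the pairs `ι_d g, ι_{dp} g` (`p ∤ d`) the operator `U_p` acts by
`U_p ι_d g = a_p(g) ι_d g - p^{k-1} ι_{dp} g`, `U_p ι_{dp} g = ι_d g` (Diamond–Shurman Prop. 5.6.2,
second diagram: the matrix `(T_p, -1; p^{k-1}, 0)` with `⟨p⟩ = 1`, characteristic polynomial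
`X² - a_p(g) X + p^{k-1}`). [cite: DiamondShurman2005, Prop. 5.6.2] -/
theorem heckeT_heckeT_sub_add_eq_zero_of_mem_span_of_not_dvd {M : ℕ} [NeZero M] (hpM : ¬ p ∣ M)
    (hpL : p ∣ L) (hp2 : ¬ p ^ 2 ∣ L) {g : CuspForm (Gamma0 M) k} (hg : IsNewform0 g)
    {v : CuspForm (Gamma0 L) k}
    (hv : v ∈ Submodule.span ℂ
      {v | ∃ (d : ℕ) (_ : NeZero d), M * d ∣ L ∧ v = degeneracyMap0 M L d k g}) :
    heckeT (Gamma0 L) k p (heckeT (Gamma0 L) k p v) -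
        (qExpansion 1 ⇑g).coeff p • heckeT (Gamma0 L) k p v + (p : ℂ) ^ (k - 1) • v = 0 := by
  have hp : p.Prime := Fact.out
  haveI : NeZero p := ⟨hp.ne_zero⟩
  set U : Module.End ℂ (CuspForm (Gamma0 L) k) := heckeT (Gamma0 L) k p with hU
  set ap : ℂ := (qExpansion 1 ⇑g).coeff p with hap
  let Φ : Module.End ℂ (CuspForm (Gamma0 L) k) := U * U - ap • U + (p : ℂ) ^ (k - 1) • 1
  have hΦ : ∀ w, Φ w = U (U w) - ap • U w + (p : ℂ) ^ (k - 1) • w := fun w ↦ rfl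
  suffices h : Submodule.span ℂ
      {v | ∃ (d : ℕ) (_ : NeZero d), M * d ∣ L ∧ v = degeneracyMap0 M L d k g} ≤
      LinearMap.ker Φ by
    have := h hv
    rwa [LinearMap.mem_ker, hΦ] at this
  -- the two relations on `ι_e g`, `ι_{ep} g` for `p ∤ e`
  have hUg : heckeT (Gamma0 M) k p g = ap • g := IsNewform0.heckeT_eq_coeff_smul hg hp
  have hrel : ∀ (e : ℕ) [NeZero e] (he : ¬ p ∣ e) (h1 : M * e ∣ L) (h2 : M * (e * p) ∣ L),
      U (iota M L e k h1 g) = ap • iota M L e k h1 g - (p : ℂ) ^ (k - 1) • iota M L (e * p) k h2 g ∧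
        U (iota M L (e * p) k h2 g) = iota M L e k h1 g := by
    intro e _ he h1 h2
    refine ⟨?_, ?_⟩
    · rw [hU, heckeT_iota_of_dvd_of_not_dvd h1 h2 hp hpL hpM he, hUg, map_smul]
    · have h2' : M * (p * e) ∣ L := by rwa [mul_comm p e]
      rw [iota_congr (mul_comm e p) h2 h2' g, hU]
      exact heckeT_iota_mul h2' h1 hp hpL g
  have hdvd_of : ∀ (e : ℕ), ¬ p ∣ e → M * e ∣ L → M * (e * p) ∣ L := by
    intro e he h1
    have hcop : Nat.Coprime (M * e) p :=
      Nat.Coprime.mul_left ((Nat.Prime.coprime_iff_not_dvd hp).mpr hpM |>.symm)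
        ((Nat.Prime.coprime_iff_not_dvd hp).mpr he |>.symm)
    rw [← mul_assoc]
    exact hcop.mul_dvd_of_dvd_of_dvd h1 hpL
  refine Submodule.span_le.mpr ?_
  rintro _ ⟨d, _, hMd, rfl⟩
  rw [SetLike.mem_coe, LinearMap.mem_ker, degeneracyMap0_eq_smul_iota M L d k hMd, map_smul,
    smul_eq_zero]
  refine Or.inr ?_
  rw [hΦ]
  by_cases hpd : p ∣ d
  · -- `d = e p` with `p ∤ e`
    obtain ⟨e, rfl⟩ := hpd
    have he : ¬ p ∣ e := by
      rintro ⟨e', rfl⟩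
      exact hp2 ((show p ^ 2 ∣ M * (p * (p * e')) from ⟨M * e', by ring⟩).trans hMd)
    haveI : NeZero e := ⟨fun h0 ↦ by simp [h0] at *⟩
    have h1 : M * e ∣ L := (mul_dvd_mul_left M (dvd_mul_left e p)).trans hMd
    have h2 : M * (e * p) ∣ L := by rwa [mul_comm e p]
    rw [iota_congr (mul_comm p e) hMd h2 g]
    obtain ⟨hA, hB⟩ := hrel e he h1 h2
    rw [hB, hA]
    abel
  · have h2 : M * (d * p) ∣ L := hdvd_of d hpd hMd
    haveI : NeZero (d * p) := ⟨mul_ne_zero (NeZero.ne d) hp.ne_zero⟩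
    obtain ⟨hA, hB⟩ := hrel d hpd hMd h2
    rw [hA, map_sub, map_smul, map_smul, hA, hB, smul_sub, smul_smul, smul_smul]
    module

end UpRelations

/-! ### `p`-stabilised ordinary eigenforms of weight `k > 2` come from level prime to `p` -/

section Ordinary

variable {p : ℕ} [Fact p.Prime]

/-- **`a_p(g)² = p^{k-2}` for a newform of level exactly divisible by `p`** (Miyake, *Modular
Forms*, Thm. 4.6.17 (2); Knapp 1993, Thm. 9.27: `a_p = -p^{k/2-1} λ(p)` with the Atkin–Lehner
eigenvalue `λ(p) = ±1`, tree `IsNewform0.atkinLehnerEigenvalueAt_eq_of_not_dvd`,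
`IsNewform0.atkinLehnerEigenvalueAt_eq_one_or_eq_neg_one`). [cite: Knapp1993, Thm. 9.27] -/
theorem IsNewform0.coeff_sq_eq_of_exactly_dvd {N M : ℕ} [NeZero N] {k : ℤ} (hN : N = p * M)
    (hpM : ¬ p ∣ M) {g : CuspForm (Gamma0 N) k} (hg : IsNewform0 g) :
    (qExpansion 1 ⇑g).coeff p ^ 2 = (p : ℂ) ^ (k - 2) := by
  have hp : p.Prime := Fact.out
  have hp0 : (0 : ℝ) < p := by exact_mod_cast hp.pos
  have hlam := hg.atkinLehnerEigenvalueAt_eq_of_not_dvd p hN hpM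
  have hpN : p ∣ N := by rw [hN]; exact dvd_mul_right p M
  have hsq : atkinLehnerEigenvalueAt g p ^ 2 = 1 := by
    obtain h | h := hg.atkinLehnerEigenvalueAt_eq_one_or_eq_neg_one hp hpN
    · rw [h, one_pow]
    · rw [h, neg_one_sq]
  set r : ℝ := (p : ℝ) ^ (1 - (k : ℝ) / 2) with hr
  have hr2 : ((r : ℂ)) ^ 2 * (p : ℂ) ^ (k - 2) = 1 := by
    have h1 : r ^ 2 = (p : ℝ) ^ ((2 : ℤ) - k) := by
      rw [hr, ← Real.rpow_natCast, ← Real.rpow_mul hp0.le, ← Real.rpow_intCast]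
      congr 1
      push_cast
      ring
    have h2 : ((r : ℂ)) ^ 2 = (p : ℂ) ^ ((2 : ℤ) - k) := by
      rw [← Complex.ofReal_pow, h1, Complex.ofReal_zpow, Complex.ofReal_natCast]
    rw [h2, ← zpow_add₀ (Nat.cast_ne_zero.mpr hp.ne_zero)]
    simp
  rw [hlam, mul_pow, neg_sq] at hsq
  -- `r² a_p² = 1` and `r² p^{k-2} = 1`
  have hr0 : ((r : ℂ)) ^ 2 ≠ 0 := by
    intro h0
    rw [h0, zero_mul] at hsq
    exact zero_ne_one hsq
  exact mul_left_cancel₀ hr0 (hsq.trans hr2.symm)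

set_option maxHeartbeats 800000 in
/-- **`p`-stabilised ordinary eigenforms of weight `k > 2` are `p`-old, and come from a
`p`-ordinary newform of level prime to `p`** (Hida, *Elementary Modular Iwasawa Theory*, proof of
Cor. 4.1.30 via Miyake Thm. 4.6.17; Miyake Thm. 4.6.17 (2); Gouvêa–Mazur / Hida's
"`p`-stabilisation").  Let `p ∤ N`, `k > 2`, `ι : ℚ̄_p ≃ ℂ`, and let `F ∈ S_k(Γ₀(Np))`, `F ≠ 0`,
satisfy `T_q F = a_q F` for the primes `q ∤ Np` and `U_p F = u F` with `|ι⁻¹ u|_p = 1`.  Then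
there are `M ∣ N` (so `p ∤ M`) and a newform `g ∈ S_k(Γ₀(M))` with `a_q(g) = a_q` (`q ∤ Np`),
`u² - a_p(g) u + p^{k-1} = 0` (so `u` is the unit root of the `p`-th Hecke polynomial of `g`) and
`|ι⁻¹ a_p(g)|_p = 1`; moreover `F` is a combination of the `[α_d]_k g`, `M d ∣ Np`.  Indeed the
newform `g` of level `M ∣ Np` behind `F` (`exists_isNewform0_mem_span_of_eigenpacket`) cannot have
`p ∣ M`: then `U_p = a_p(g)` on the old forms from `g` and `a_p(g)² = p^{k-2}` is not a `p`-adic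
unit for `k > 2` (`IsNewform0.coeff_sq_eq_of_exactly_dvd`); and for `p ∤ M` the quadratic relation
holds on the old forms from `g` (`heckeT_heckeT_sub_add_eq_zero_of_mem_span_of_not_dvd`), whence
`a_p(g) = u + p^{k-1}/u ≡ u`. [cite: Hida2022EMI, Cor. 4.1.30 (proof)] [cite: DiamondShurman2005, Prop. 5.6.2] -/
theorem exists_isNewform0_of_ordinary_pStabilised (ι : PadicAlgCl p ≃+* ℂ) {N : ℕ} [NeZero N]
    (hpN : ¬ p ∣ N) {k : ℤ} (hk : 2 < k) {F : CuspForm (Gamma0 (N * p)) k} (hF0 : F ≠ 0)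
    {a : ℕ → ℂ}
    (hT : ∀ (q : ℕ) (hq : q.Prime), ¬ q ∣ N * p →
      (haveI : NeZero q := ⟨hq.ne_zero⟩; heckeT (Gamma0 (N * p)) k q F) = a q • F)
    {u : ℂ} (hU : (haveI : NeZero p := ⟨(Fact.out : p.Prime).ne_zero⟩;
      heckeT (Gamma0 (N * p)) k p F) = u • F)
    (hu : ‖ι.symm u‖ = 1) :
    ∃ (M : ℕ) (_ : NeZero M) (_ : M ∣ N) (g : CuspForm (Gamma0 M) k), IsNewform0 g ∧
      (∀ q : ℕ, q.Prime → ¬ q ∣ N * p → (qExpansion 1 ⇑g).coeff q = a q) ∧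
      u ^ 2 - (qExpansion 1 ⇑g).coeff p * u + (p : ℂ) ^ (k - 1) = 0 ∧
      ‖ι.symm ((qExpansion 1 ⇑g).coeff p)‖ = 1 ∧
      F ∈ Submodule.span ℂ
        {v | ∃ (d : ℕ) (_ : NeZero d), M * d ∣ N * p ∧ v = degeneracyMap0 M (N * p) d k g} := by
  have hp : p.Prime := Fact.out
  haveI : NeZero p := ⟨hp.ne_zero⟩
  have hpL : p ∣ N * p := dvd_mul_left p N
  have hp2 : ¬ p ^ 2 ∣ N * p := by
    rw [pow_two]
    intro h
    exact hpN ((Nat.mul_dvd_mul_iff_right hp.pos).mp h)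
  obtain ⟨M, _, hML, g, hgnew, hga, hspan⟩ := exists_isNewform0_mem_span_of_eigenpacket hF0 hT
  have hu0 : u ≠ 0 := by
    intro h0
    rw [h0, map_zero, norm_zero] at hu
    exact zero_ne_one hu
  -- ### `p ∤ M`
  have hpM : ¬ p ∣ M := by
    intro hpM
    -- `U_p = a_p(g)` on `F`, so `u = a_p(g)`, and `a_p(g)² = p^{k-2}`
    have h1 := heckeT_eq_smul_of_mem_span_of_dvd hpM hp2 hgnew hspan
    rw [hU] at h1
    have hua : u = (qExpansion 1 ⇑g).coeff p := smul_left_injective ℂ hF0 h1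
    obtain ⟨M', rfl⟩ := hpM
    have hpM' : ¬ p ∣ M' := by
      rintro ⟨M'', rfl⟩
      exact hp2 ((show p ^ 2 ∣ p * (p * M'') from ⟨M'', by ring⟩).trans hML)
    have hsq := hgnew.coeff_sq_eq_of_exactly_dvd rfl hpM'
    rw [← hua] at hsq
    -- norms: `‖ι⁻¹ u‖² = ‖p‖^{k-2} < 1`
    obtain ⟨m, hm⟩ : ∃ m : ℕ, k - 2 = (m : ℤ) + 1 := ⟨(k - 3).toNat, by omega⟩
    have hn : ‖ι.symm u‖ ^ 2 = ‖(p : PadicAlgCl p)‖ ^ (m + 1) := by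
      rw [← norm_pow, ← map_pow, hsq, hm, show ((m : ℤ) + 1) = ((m + 1 : ℕ) : ℤ) by push_cast; ring,
        zpow_natCast, map_pow, map_natCast, norm_pow]
    rw [hu, one_pow] at hn
    have hlt : ‖(p : PadicAlgCl p)‖ ^ (m + 1) < 1 :=
      pow_lt_one₀ (norm_nonneg _) norm_natCast_prime_lt_one (Nat.succ_ne_zero m)
    rw [← hn] at hlt
    exact lt_irrefl _ hlt
  -- ### `M ∣ N` and the quadratic relation
  have hMN : M ∣ N :=
    ((Nat.Prime.coprime_iff_not_dvd hp).mpr hpM).symm.dvd_of_dvd_mul_right hML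
  have hquad := heckeT_heckeT_sub_add_eq_zero_of_mem_span_of_not_dvd hpM hpL hp2 hgnew hspan
  rw [hU, map_smul, hU, smul_smul, smul_smul, ← sub_smul, ← add_smul, smul_eq_zero] at hquad
  have hquad' : u ^ 2 - (qExpansion 1 ⇑g).coeff p * u + (p : ℂ) ^ (k - 1) = 0 := by
    rcases hquad with h | h
    · linear_combination h
    · exact absurd h hF0
  -- ### `a_p(g) = u + p^{k-1}/u` is a `p`-adic unit
  have hap : (qExpansion 1 ⇑g).coeff p = u + (p : ℂ) ^ (k - 1) * u⁻¹ := by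
    have h1 : (qExpansion 1 ⇑g).coeff p * u = (u + (p : ℂ) ^ (k - 1) * u⁻¹) * u := by
      rw [add_mul, inv_mul_cancel_right₀ hu0]
      linear_combination -hquad'
    exact mul_right_cancel₀ hu0 h1
  have hnorm : ‖ι.symm ((qExpansion 1 ⇑g).coeff p)‖ = 1 := by
    obtain ⟨m, hm⟩ : ∃ m : ℕ, k - 1 = (m : ℤ) + 1 := ⟨(k - 2).toNat, by omega⟩
    have hsmall : ‖ι.symm ((p : ℂ) ^ (k - 1) * u⁻¹)‖ < 1 := by
      rw [map_mul, map_inv₀, norm_mul, norm_inv, hu, inv_one, mul_one, hm,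
        show ((m : ℤ) + 1) = ((m + 1 : ℕ) : ℤ) by push_cast; ring, zpow_natCast, map_pow,
        map_natCast, norm_pow]
      exact pow_lt_one₀ (norm_nonneg _) norm_natCast_prime_lt_one (Nat.succ_ne_zero m)
    rw [hap, map_add]
    refine norm_eq_one_of_norm_sub_lt_one hu ?_
    rwa [add_sub_cancel_left]
  exact ⟨M, inferInstance, hMN, g, hgnew, hga, hquad', hnorm, hspan⟩

/-- `degeneracyMap0 M L d k` only depends on the value of `d`. [folklore] -/
theorem degeneracyMap0_congr {M L d d' : ℕ} [NeZero M] [NeZero L] [NeZero d] [NeZero d'] {k : ℤ}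
    (h : d = d') : degeneracyMap0 M L d k = degeneracyMap0 M L d' k := by
  subst h
  rfl

/-- **Old forms from a level `M ∣ L/q` are `q`-old; a `q`-new one vanishes.**  Let `L = q L'`,
`M ∣ L'`, `g ∈ S_k(Γ₀(M))`, and let `F` be a combination of the `[α_d]_k g`, `M d ∣ L`; if `F` is
`q`-new at level `L` (killed by the two adjoint degeneracy maps to level `L'`), then `F = 0`:
every `[α_d]_k g` factors through level `L'` (through `[α_1]_k` if `q ∤ d`, through `[α_q]_k` if
`q ∣ d`; Diamond–Shurman Exercise 5.6.2, tree `map_degeneracyMap0_le_pOld_of_dvd/_of_mul`), so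
`F` is `q`-old, and `q`-old `∩` `q`-new `= 0` (`disjoint_pOld_pNew`, Diamond–Shurman Prop. 5.5.2
with §5.4). [cite: DiamondShurman2005, Exercise 5.6.2 and Prop. 5.5.2] -/
theorem eq_zero_of_mem_span_of_mem_pNew {L L' M q : ℕ} [NeZero L] [NeZero L'] [NeZero M]
    [NeZero q] {k : ℤ} (hL : L = q * L') (hq : q.Prime) (hML' : M ∣ L')
    {g : CuspForm (Gamma0 M) k} {F : CuspForm (Gamma0 L) k}
    (hspan : F ∈ Submodule.span ℂ
      {v | ∃ (d : ℕ) (_ : NeZero d), M * d ∣ L ∧ v = degeneracyMap0 M L d k g})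
    (hnew : F ∈ LinearMap.ker (adjDegeneracyMap0 L L' 1 k) ⊓
      LinearMap.ker (adjDegeneracyMap0 L L' q k)) : F = 0 := by
  have hL'L : L' * q ∣ L := ⟨1, by rw [hL]; ring⟩
  -- `F` is `q`-old
  have hold : F ∈ LinearMap.range (degeneracyMap0 L' L 1 k) ⊔
      LinearMap.range (degeneracyMap0 L' L q k) := by
    refine (Submodule.span_le.mpr ?_) hspan
    rintro _ ⟨d, _, hMd, rfl⟩
    obtain ⟨t, ht⟩ := hML'
    by_cases hqd : q ∣ d
    · obtain ⟨d₀, rfl⟩ := hqd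
      haveI : NeZero d₀ := ⟨fun h0 ↦ by simp [h0] at *⟩
      have h0 : M * d₀ ∣ L' := by
        have : M * (q * d₀) ∣ q * L' := hL ▸ hMd
        rw [show M * (q * d₀) = q * (M * d₀) by ring] at this
        exact Nat.dvd_of_mul_dvd_mul_left hq.pos this
      rw [SetLike.mem_coe, degeneracyMap0_congr (Nat.mul_comm q d₀)]
      exact map_degeneracyMap0_le_pOld_of_mul h0 hL'L ⊤ (Submodule.mem_map_of_mem trivial)
    · have hcop : Nat.Coprime d q := (Nat.coprime_comm.mp ((Nat.Prime.coprime_iff_not_dvd hq).mpr hqd))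
      have h0 : M * d ∣ L' := by
        have h1 : M * d ∣ q * (M * t) := by rw [← ht, ← hL]; exact hMd
        have h2 : d ∣ q * t := by
          have : M * d ∣ M * (q * t) := by rwa [show M * (q * t) = q * (M * t) by ring]
          exact Nat.dvd_of_mul_dvd_mul_left (NeZero.pos M) this
        rw [ht]
        exact mul_dvd_mul_left M (hcop.dvd_of_dvd_mul_left h2)
      have hL'dvd : L' ∣ L := ⟨q, by rw [hL, mul_comm]⟩
      exact map_degeneracyMap0_le_pOld_of_dvd h0 hL'dvd ⊤ (Submodule.mem_map_of_mem trivial)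
  exact Submodule.disjoint_def.mp (disjoint_pOld_pNew hL) F hold hnew

set_option maxHeartbeats 800000 in
/-- **`p`-stabilised ordinary NEW eigenforms of tame level `N` and weight `k > 2` come from
`p`-ordinary newforms of level exactly `N`** — the last, classical step of the derivation of
`hida_exists_congruent_ordinary_newform` from Hida's `Λ`-adic theory (Hida, *Elementary Modular
Iwasawa Theory*, Cor. 4.1.30 with Miyake Thm. 4.6.17; Emerton–Pollack–Weston 2006, §2.1–2.2:
the weight-`k` member of the family is a `p`-stabilised newform of tame conductor `N`).  With the
hypotheses of `exists_isNewform0_of_ordinary_pStabilised` and, in addition, `F` new at every prime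
`q ∣ N` (killed by the adjoint degeneracy maps from level `N p` to level `N p / q`), the newform `g`
has level `N`: `a_q(g) = a_q` (`q ∤ Np`), `u² - a_p(g) u + p^{k-1} = 0`, `|ι⁻¹ a_p(g)|_p = 1`.
[cite: Hida2022EMI, Cor. 4.1.30 (proof)] [cite: EmertonPollackWeston2005, §2.2, Thm. 2.2.2] -/
theorem exists_isNewform0_level_of_ordinary_pStabilised_of_new (ι : PadicAlgCl p ≃+* ℂ) {N : ℕ}
    [NeZero N] (hpN : ¬ p ∣ N) {k : ℤ} (hk : 2 < k) {F : CuspForm (Gamma0 (N * p)) k} (hF0 : F ≠ 0)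
    {a : ℕ → ℂ}
    (hT : ∀ (q : ℕ) (hq : q.Prime), ¬ q ∣ N * p →
      (haveI : NeZero q := ⟨hq.ne_zero⟩; heckeT (Gamma0 (N * p)) k q F) = a q • F)
    {u : ℂ} (hU : (haveI : NeZero p := ⟨(Fact.out : p.Prime).ne_zero⟩;
      heckeT (Gamma0 (N * p)) k p F) = u • F)
    (hu : ‖ι.symm u‖ = 1)
    (hFnew : ∀ (q L' : ℕ) (hq : q.Prime) (_ : NeZero L'), q ∣ N → N * p = q * L' →
      (haveI : NeZero q := ⟨hq.ne_zero⟩;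
        F ∈ LinearMap.ker (adjDegeneracyMap0 (N * p) L' 1 k) ⊓
          LinearMap.ker (adjDegeneracyMap0 (N * p) L' q k))) :
    ∃ g : CuspForm (Gamma0 N) k, IsNewform0 g ∧
      (∀ q : ℕ, q.Prime → ¬ q ∣ N * p → (qExpansion 1 ⇑g).coeff q = a q) ∧
      u ^ 2 - (qExpansion 1 ⇑g).coeff p * u + (p : ℂ) ^ (k - 1) = 0 ∧
      ‖ι.symm ((qExpansion 1 ⇑g).coeff p)‖ = 1 := by
  have hp : p.Prime := Fact.out
  obtain ⟨M, _, hMN, g, hgnew, hga, hquad, hnorm, hspan⟩ :=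
    exists_isNewform0_of_ordinary_pStabilised ι hpN hk hF0 hT hU hu
  -- ### `M = N`
  suffices hMN' : M = N by
    subst hMN'
    exact ⟨g, hgnew, hga, hquad, hnorm⟩
  by_contra hne
  obtain ⟨t, ht⟩ := hMN
  have ht1 : t ≠ 1 := fun h1 ↦ hne (by rw [ht, h1, mul_one])
  have ht0 : t ≠ 0 := fun h0 ↦ NeZero.ne N (by rw [ht, h0, mul_zero])
  obtain ⟨q, hq, hqt⟩ := Nat.exists_prime_and_dvd ht1
  haveI : NeZero q := ⟨hq.ne_zero⟩
  obtain ⟨t', rfl⟩ := hqt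
  -- `N p = q L'` with `L' = M t' p`, and `M ∣ L'`
  set L' : ℕ := M * t' * p with hL'
  haveI : NeZero L' := ⟨by
    rw [hL']
    exact mul_ne_zero (mul_ne_zero (NeZero.ne M) (right_ne_zero_of_mul ht0)) hp.ne_zero⟩
  have hNp : N * p = q * L' := by rw [ht, hL']; ring
  have hqN : q ∣ N := ⟨M * t', by rw [ht]; ring⟩
  have hML' : M ∣ L' := ⟨t' * p, by rw [hL']; ring⟩
  exact hF0 (eq_zero_of_mem_span_of_mem_pNew hNp hq hML' hspan (hFnew q L' hq inferInstance hqN hNp))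

set_option maxHeartbeats 800000 in
/-- **The `p`-stabilisation of a `p`-ordinary newform** (forwards; Hida 1986, (1.9); Wiles 1988,
§1.2; Diamond–Shurman Prop. 5.6.2).  Let `p ∤ N`, `k ≥ 2`, `ι : ℚ̄_p ≃ ℂ`, and `f ∈ S_k(Γ₀(N))` a
newform with `|ι⁻¹ a_p(f)|_p = 1`.  Then there are a unit root `u` of `X² - a_p(f) X + p^{k-1}`
(`|ι⁻¹ u|_p = 1`) and a normalised (`a₁ = 1`, so non-zero) form `F ∈ S_k(Γ₀(Np))` — namely
`F = f - (a_p(f) - u) f(pτ) = ι_1 f - (a_p - u) ι_p f` — with `T_q F = a_q(f) F` for the primes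
`q ∤ Np`, `U_p F = u F`, and `F` new at every prime `q ∣ N` (killed by the adjoint degeneracy maps
to level `Np/q`): the `p`-ordinary `p`-stabilised newform of tame level `N` attached to `f`, the
classical INPUT of Hida's `Λ`-adic theory (the weight-`k` point of the Hida family through `f`).
Together with `exists_isNewform0_level_of_ordinary_pStabilised_of_new` (backwards, `k > 2`) this
is the classical interface of the `Λ`-adic step missing from the proof of
`hida_exists_congruent_ordinary_newform`. [cite: Hida1986, (1.9)] [cite: DiamondShurman2005, Prop. 5.6.2] -/
theorem exists_ordinary_pStabilised_of_isNewform0 (ι : PadicAlgCl p ≃+* ℂ) {N : ℕ} [NeZero N]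
    (hpN : ¬ p ∣ N) {k : ℤ} (hk : 2 ≤ k) {f : CuspForm (Gamma0 N) k} (hf : IsNewform0 f)
    (hord : ‖ι.symm ((qExpansion 1 ⇑f).coeff p)‖ = 1) :
    ∃ (u : ℂ) (F : CuspForm (Gamma0 (N * p)) k),
      ‖ι.symm u‖ = 1 ∧ u ^ 2 - (qExpansion 1 ⇑f).coeff p * u + (p : ℂ) ^ (k - 1) = 0 ∧
      (qExpansion 1 ⇑F).coeff 1 = 1 ∧
      (∀ (q : ℕ) (hq : q.Prime), ¬ q ∣ N * p →
        (haveI : NeZero q := ⟨hq.ne_zero⟩; heckeT (Gamma0 (N * p)) k q F) =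
          (qExpansion 1 ⇑f).coeff q • F) ∧
      (haveI : NeZero p := ⟨(Fact.out : p.Prime).ne_zero⟩; heckeT (Gamma0 (N * p)) k p F) = u • F ∧
      (∀ (q L' : ℕ) (hq : q.Prime) (_ : NeZero L'), q ∣ N → N * p = q * L' →
        (haveI : NeZero q := ⟨hq.ne_zero⟩;
          F ∈ LinearMap.ker (adjDegeneracyMap0 (N * p) L' 1 k) ⊓
            LinearMap.ker (adjDegeneracyMap0 (N * p) L' q k))) := by
  have hp : p.Prime := Fact.out
  haveI : NeZero p := ⟨hp.ne_zero⟩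
  set ap : ℂ := (qExpansion 1 ⇑f).coeff p with hap
  -- ### the unit root `u` of `X² - a_p X + p^{k-1}` (through `ι`)
  obtain ⟨m, hm⟩ : ∃ m : ℕ, k - 1 = (m : ℤ) + 1 := ⟨(k - 2).toNat, by omega⟩
  have hc : ‖ι.symm ((p : ℂ) ^ (k - 1))‖ < 1 := by
    rw [hm, show ((m : ℤ) + 1) = ((m + 1 : ℕ) : ℤ) by push_cast; ring, zpow_natCast, map_pow,
      map_natCast, norm_pow]
    exact pow_lt_one₀ (norm_nonneg _) norm_natCast_prime_lt_one (Nat.succ_ne_zero m)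
  obtain ⟨α, hα, hαr, -⟩ := exists_quadratic_unitRoot hord hc
  set u : ℂ := ι α with hu
  have hιu : ι.symm u = α := by rw [hu, RingEquiv.symm_apply_apply]
  have hur : u ^ 2 - ap * u + (p : ℂ) ^ (k - 1) = 0 := by
    apply ι.symm.injective
    rw [map_add, map_sub, map_pow, map_mul, hιu, map_zero]
    exact hαr
  -- ### the form `F = ι_1 f - (a_p - u) ι_p f`
  have h1 : N * 1 ∣ N * p := mul_dvd_mul_left N (one_dvd p)
  have hp1 : N * (1 * p) ∣ N * p := by rw [one_mul]
  have hp' : N * p ∣ N * p := dvd_rfl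
  set F : CuspForm (Gamma0 (N * p)) k :=
    iota N (N * p) 1 k h1 f - (ap - u) • iota N (N * p) p k hp' f with hF
  have hpL : p ∣ N * p := dvd_mul_left p N
  -- `U_p` on the two pieces
  have hUf : heckeT (Gamma0 N) k p f = ap • f := IsNewform0.heckeT_eq_coeff_smul hf hp
  have hU1 : heckeT (Gamma0 (N * p)) k p (iota N (N * p) 1 k h1 f) =
      ap • iota N (N * p) 1 k h1 f - (p : ℂ) ^ (k - 1) • iota N (N * p) p k hp' f := by
    rw [heckeT_iota_of_dvd_of_not_dvd h1 hp1 hp hpL hpN hp.not_dvd_one, hUf, map_smul,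
      iota_congr (one_mul p) hp1 hp' f]
  have hUp : heckeT (Gamma0 (N * p)) k p (iota N (N * p) p k hp' f) = iota N (N * p) 1 k h1 f := by
    have hp1' : N * (p * 1) ∣ N * p := by rw [mul_one]
    rw [iota_congr (mul_one p).symm hp' hp1' f]
    exact heckeT_iota_mul hp1' h1 hp hpL f
  refine ⟨u, F, by rw [hιu]; exact hα, hur, ?_, ?_, ?_, ?_⟩
  · -- `a_1(F) = 1`
    rw [hF, qExpansion_coeff_sub_level0, qExpansion_coeff_smul, qExpansion_coeff_iota,
      qExpansion_coeff_iota, if_pos (one_dvd 1), Nat.div_one, if_neg hp.not_dvd_one,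
      show (qExpansion 1 ⇑f).coeff 1 = 1 from hf.2.2]
    ring
  · -- `T_q F = a_q(f) F` for `q ∤ Np`
    intro q hq hqL
    haveI : NeZero q := ⟨hq.ne_zero⟩
    have hTf : heckeT (Gamma0 N) k q f = (qExpansion 1 ⇑f).coeff q • f :=
      IsNewform0.heckeT_eq_coeff_smul hf hq
    rw [hF, map_sub, map_smul, heckeT_iota h1 hq hqL, heckeT_iota hp' hq hqL, hTf, map_smul,
      map_smul, smul_sub, smul_comm]
  · -- `U_p F = u F`
    have huu : u * (ap - u) = (p : ℂ) ^ (k - 1) := by linear_combination -hur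
    rw [hF, map_sub, map_smul, hU1, hUp, smul_sub, smul_smul, huu]
    module
  · -- `F` is new at the primes `q ∣ N`
    intro q L' hq _ hqN hNp
    haveI : NeZero q := ⟨hq.ne_zero⟩
    obtain ⟨Q, hQ⟩ := hqN
    haveI : NeZero Q := ⟨fun h0 ↦ NeZero.ne N (by rw [hQ, h0, mul_zero])⟩
    have hqp : ¬ q ∣ p := fun h ↦ hpN (((Nat.prime_dvd_prime_iff_eq hq hp).mp h) ▸ ⟨Q, hQ⟩)
    have hfnew : f ∈ newSubspace0 N k := hf.1
    have hmem : ∀ (d c : ℕ) [NeZero d] [NeZero c], N * d * c = N * p → ¬ q ∣ d → ¬ q ∣ c →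
        degeneracyMap0 N (N * p) d k f ∈ LinearMap.ker (adjDegeneracyMap0 (N * p) L' 1 k) ⊓
          LinearMap.ker (adjDegeneracyMap0 (N * p) L' q k) :=
      fun d c _ _ hdc hd hc' ↦ degeneracyMap0_mem_pNew hq hNp hQ hdc hd hc' hfnew
    have hm1 := hmem 1 p (by ring) hq.not_dvd_one hqp
    have hmp := hmem p 1 (by ring) hqp hq.not_dvd_one
    rw [degeneracyMap0_eq_smul_iota N (N * p) 1 k h1] at hm1
    rw [degeneracyMap0_eq_smul_iota N (N * p) p k hp'] at hmp
    set W := LinearMap.ker (adjDegeneracyMap0 (N * p) L' 1 k) ⊓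
      LinearMap.ker (adjDegeneracyMap0 (N * p) L' q k)
    have hm1' : iota N (N * p) 1 k h1 f ∈ W := by
      simpa using hm1
    have hmp' : iota N (N * p) p k hp' f ∈ W := by
      have hpk : ((p : ℂ) ^ (k - 1)) ≠ 0 := zpow_ne_zero _ (Nat.cast_ne_zero.mpr hp.ne_zero)
      exact (Submodule.smul_mem_iff W hpk).mp hmp
    rw [hF]
    exact W.sub_mem hm1' (W.smul_mem _ hmp')

end Ordinary

end Literature.NumberTheory.EllipticCurves.ModularForms

/-! ### The elliptic-curve statement with level dividing the conductor -/

namespace Literature.NumberTheory.EllipticCurves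

open Literature.NumberTheory.EllipticCurves.ModularForms IsDedekindDomain

/-- **A prime not dividing the conductor is a prime of good reduction** (`N_E = ∏ ℓ^{f_ℓ}`,
`factorization_conductorNorm_holds`; `f_ℓ = 0` iff good reduction, Silverman ATAEC IV.10.2(a),
`conductorExponent_eq_zero_iff_holds`; prime-indexed vs place-indexed good reduction,
`hasGoodReductionAtPrime_iff_hasGoodReductionAt_holds`) — converse bookkeeping of
`not_dvd_conductorNorm_of_hasGoodReductionAtPrime`. [cite: Silverman1994, IV.10.2(a)] -/
theorem hasGoodReductionAtPrime_of_not_dvd_conductorNorm (W : WeierstrassCurve ℚ) [W.IsElliptic]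
    {ℓ : ℕ} [hℓ : Fact ℓ.Prime] (h : ¬ ℓ ∣ W.conductorNorm ℤ) : W.HasGoodReductionAtPrime ℓ := by
  set v : HeightOneSpectrum ℤ := (Rat.HeightOneSpectrum.primesEquiv (R := ℤ)).symm ⟨ℓ, hℓ.out⟩
    with hv
  have hgen : Rat.HeightOneSpectrum.natGenerator v = ℓ :=
    congrArg Subtype.val ((Rat.HeightOneSpectrum.primesEquiv (R := ℤ)).apply_symm_apply ⟨ℓ, hℓ.out⟩)
  have hfac : (W.conductorNorm ℤ).factorization ℓ = 0 := Nat.factorization_eq_zero_of_not_dvd h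
  have hf : W.conductorExponent v = 0 := by
    rw [← W.factorization_conductorNorm_holds v, hgen, hfac]
  have hgood' : W.HasGoodReductionAt v :=
    (WeierstrassCurve.conductorExponent_eq_zero_iff_holds v W).mp hf
  exact (W.hasGoodReductionAtPrime_iff_hasGoodReductionAt_holds ⟨ℓ, hℓ.out⟩).mpr hgood'

/-- **Classical members of the Hida family of an ordinary elliptic curve, up to the level**
(the statement of `hida_exists_congruent_ordinary_newform` with "newform of level `N`" weakened
to "newform of some level `M ∣ N`"), PROVED from the Modularity Theorem alone
(`Literature.NumberTheory.EllipticCurves.ModularForms.exists_isNewformOf`, Breuil–Conrad–Diamond–Taylor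
2001, Thm. A): for `E/ℚ` with globally minimal equation `W` of conductor `N`, a prime `p ≥ 5` of
good ordinary reduction and an integer `k > 2` with `k ≡ 2 (mod p - 1)`, there are `M ∣ N`, a
newform `g ∈ S_k(Γ₀(M))` and `ι : K_g →+* ℚ̄_p` with `|ι(a_p(g))|_p = 1` and
`|ι(a_ℓ(g)) - a_ℓ(E)|_p < 1` for all primes `ℓ ∤ N p`.  Proof: modularity gives the newform
`f_E ∈ S_2(Γ₀(N))` with `a_ℓ(f_E) = a_ℓ(E)` (`= frobeniusTrace` at good `ℓ`,
`LFunction_apply_prime_eq_frobeniusTrace`) and `p ∤ N` (`not_dvd_level_of_isNewformOf`); apply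
`exists_isNewform0_dvd_level_congr` with `w = k - 2` (Deligne–Serre 6.9–6.11 and Atkin–Lehner–Li);
`a_p(g) ≡ a_p(E)`, a `p`-adic unit.  The missing step to the named fact itself — `M = N` — is the
constancy of the tame conductor along the Hida family (Hida 1986; Emerton–Pollack–Weston 2006,
Thm. 2.2.2), which is `Λ`-adic and not formalised here.
[cite: DeligneSerreASENS1974, 6.9–6.11] [cite: BreuilConradDiamondTaylor2001, Thm. A] -/
theorem exists_isNewform0_dvd_conductorNorm_congr_of_exists_isNewformOf
    (hmod : exists_isNewformOf) (W : WeierstrassCurve ℚ) [W.IsElliptic] [W.IsGloballyMinimal]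
    [NeZero (W.conductorNorm ℤ)] (p : ℕ) [Fact p.Prime] (hp5 : 5 ≤ p)
    (hgood : W.HasGoodReductionAtPrime p) (hord : ¬ (p : ℤ) ∣ W.frobeniusTrace p)
    (k : ℤ) (hk : 2 < k) (hpk : ((p : ℤ) - 1) ∣ (k - 2)) :
    ∃ (M : ℕ) (_ : NeZero M) (_ : M ∣ W.conductorNorm ℤ) (g : CuspForm (Gamma0 M) k)
      (ι : coeffField g →+* PadicAlgCl p),
      IsNewform0 g ∧
      ‖ι ⟨(qExpansion 1 ⇑g).coeff p, coeff_mem_coeffField g p⟩‖ = 1 ∧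
      ∀ ℓ : ℕ, ℓ.Prime → ¬ ℓ ∣ W.conductorNorm ℤ * p →
        ‖ι ⟨(qExpansion 1 ⇑g).coeff ℓ, coeff_mem_coeffField g ℓ⟩
            - ((W.frobeniusTrace ℓ : ℤ) : PadicAlgCl p)‖ < 1 := by
  have hp : p.Prime := Fact.out
  -- the weight `k = 2 + w`, `w ≥ 3` even and divisible by `p - 1`
  obtain ⟨w, rfl⟩ : ∃ w : ℕ, k = 2 + (w : ℤ) := ⟨(k - 2).toNat, by omega⟩
  have hpw : (p - 1) ∣ w := by
    have h1 : ((p - 1 : ℕ) : ℤ) ∣ (w : ℤ) := by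
      rw [Nat.cast_sub hp.one_le]
      simpa using hpk
    exact_mod_cast h1
  have hw0 : w ≠ 0 := by omega
  have hw3 : 3 ≤ w := by
    have := Nat.le_of_dvd (Nat.pos_of_ne_zero hw0) hpw
    omega
  have hwe : Even w :=
    (even_iff_two_dvd.mp (hp.even_sub_one (by omega))).trans hpw |> even_iff_two_dvd.mpr
  -- modularity: the newform `f_E`, `a_ℓ(f_E) = a_ℓ(E)`, `p ∤ N`
  obtain ⟨f, hf⟩ := hmod W
  have hpN : ¬ p ∣ W.conductorNorm ℤ := not_dvd_level_of_isNewformOf hf hgood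
  have hfℓ : ∀ (ℓ : ℕ) [Fact ℓ.Prime], W.HasGoodReductionAtPrime ℓ →
      (qExpansion 1 ⇑f).coeff ℓ = (W.frobeniusTrace ℓ : ℂ) := by
    intro ℓ _ hℓ
    rw [← WeierstrassCurve.LFunction_apply_prime_eq_frobeniusTrace W ℓ hℓ]
    exact hf.2 ℓ
  -- an abstract field isomorphism `ℚ̄_p ≃ ℂ`
  obtain ⟨ι₀⟩ := PadicAlgCl.nonempty_ringEquiv_complex p
  -- the congruent newform of weight `2 + w` and level `M ∣ N`
  obtain ⟨M, _, hMN, g, hgnew, hcong⟩ :=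
    exists_isNewform0_dvd_level_congr ι₀ le_rfl hf.1 hw3 hwe hpw
  let ι : coeffField g →+* PadicAlgCl p :=
    (ι₀.symm : ℂ →+* PadicAlgCl p).comp (algebraMap (coeffField g) ℂ)
  have hι : ∀ (x : ℂ) (hx : x ∈ coeffField g), ι ⟨x, hx⟩ = ι₀.symm x := fun _ _ ↦ rfl
  have hιf : ∀ (ℓ : ℕ) [Fact ℓ.Prime], W.HasGoodReductionAtPrime ℓ →
      ι₀.symm ((qExpansion 1 ⇑f).coeff ℓ) = ((W.frobeniusTrace ℓ : ℤ) : PadicAlgCl p) := by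
    intro ℓ _ hℓ
    rw [hfℓ ℓ hℓ, map_intCast]
  refine ⟨M, inferInstance, hMN, g, ι, hgnew, ?_, fun ℓ hℓ hℓNp ↦ ?_⟩
  · -- `a_p(g) ≡ a_p(E)`, a `p`-adic unit
    have h := hcong p hp hpN
    rw [hιf p hgood] at h
    rw [hι]
    exact norm_eq_one_of_norm_sub_lt_one (DeligneSerreLift.norm_intCast_eq_one_of_not_dvd hord) h
  · have hℓN : ¬ ℓ ∣ W.conductorNorm ℤ := fun h' ↦ hℓNp (h'.mul_right p)
    haveI : Fact ℓ.Prime := ⟨hℓ⟩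
    have hgoodℓ : W.HasGoodReductionAtPrime ℓ := hasGoodReductionAtPrime_of_not_dvd_conductorNorm W hℓN
    have h := hcong ℓ hℓ hℓN
    rw [hιf ℓ hgoodℓ] at h
    rw [hι]
    exact h

/-! ### Conditional assembly of the named fact: modularity + the classical shadow of Hida 1986 -/

/-- **`hida_exists_congruent_ordinary_newform` from the Modularity Theorem and the classical
shadow of Hida's theorem on ordinary `Λ`-adic families** — a CONDITIONAL assembly which pins down
exactly what the `Λ`-adic theory has to deliver and proves that nothing else is missing.  The
second hypothesis `hHida` is NOT a fact of the tree (and is not vendored as one): it is the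
`Γ₀`/trivial-tame-character slice of Hida, Invent. Math. 85 (1986), Thm. 1.2 with Cor. 1.3 and
Cor. 1.6 (cf. Emerton–Pollack–Weston 2006, Thm. 2.2.2; Hida, *Elementary Modular Iwasawa Theory*,
Thm. 4.1.29 and Cor. 4.1.30) in classical terms — *for a `p`-ordinary newform `f ∈ S_{k₀}(Γ₀(N))`,
`p ∤ N`, `k₀ ≥ 2`, and every weight `k ≥ 2` with `k ≡ k₀ (mod p - 1)`, there is a non-zero
`p`-ordinary `p`-stabilised eigenform of weight `k` on `Γ₀(Np)`, new at the primes dividing `N`,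
whose `T_q`-eigenvalues (`q ∤ Np`) are congruent to those of `f` modulo the maximal ideal of
`𝒪_{ℚ̄_p}`* (the weight-`k` member, of tame conductor `N` by Cor. 1.3, of the primitive component
through the `p`-stabilisation `exists_ordinary_pStabilised_of_isNewform0` of `f`).  GIVEN that, the
named fact follows by the proved classical descent
`exists_isNewform0_level_of_ordinary_pStabilised_of_new` (`k > 2`: ordinary ⇒ `p`-old ⇒ a
newform of level exactly `N` with unit `a_p`) and the modularity dictionary
(`a_ℓ(f_E) = frobeniusTrace`, `p ∤ N_E`).  No `_holds` is claimed.
[cite: Hida1986, Thm. 1.2, Cor. 1.3, Cor. 1.6] [cite: EmertonPollackWeston2005, Thm. 2.2.2] -/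
theorem hida_exists_congruent_ordinary_newform_of_exists_isNewformOf_of_lambdaAdic
    (hmod : exists_isNewformOf)
    (hHida : ∀ (p : ℕ) [Fact p.Prime] (ι : PadicAlgCl p ≃+* ℂ) (N : ℕ) [NeZero N], 5 ≤ p →
      ¬ p ∣ N → ∀ (k₀ : ℤ), 2 ≤ k₀ → ∀ (f : CuspForm (Gamma0 N) k₀), IsNewform0 f →
      ‖ι.symm ((qExpansion 1 ⇑f).coeff p)‖ = 1 → ∀ (k : ℤ), 2 ≤ k → ((p : ℤ) - 1) ∣ (k - k₀) →
      ∃ (F : CuspForm (Gamma0 (N * p)) k) (b : ℕ → ℂ) (u : ℂ), F ≠ 0 ∧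
        (∀ (q : ℕ) (hq : q.Prime), ¬ q ∣ N * p →
          (haveI : NeZero q := ⟨hq.ne_zero⟩; heckeT (Gamma0 (N * p)) k q F) = b q • F) ∧
        (haveI : NeZero p := ⟨(Fact.out : p.Prime).ne_zero⟩; heckeT (Gamma0 (N * p)) k p F) =
          u • F ∧
        ‖ι.symm u‖ = 1 ∧
        (∀ (q L' : ℕ) (hq : q.Prime) (_ : NeZero L'), q ∣ N → N * p = q * L' →
          (haveI : NeZero q := ⟨hq.ne_zero⟩;
            F ∈ LinearMap.ker (adjDegeneracyMap0 (N * p) L' 1 k) ⊓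
              LinearMap.ker (adjDegeneracyMap0 (N * p) L' q k))) ∧
        (∀ q : ℕ, q.Prime → ¬ q ∣ N * p →
          ‖ι.symm (b q) - ι.symm ((qExpansion 1 ⇑f).coeff q)‖ < 1)) :
    hida_exists_congruent_ordinary_newform := by
  intro W _ _ hNz p _ hp5 hgood hord k hk hpk
  haveI := hNz
  have hp : p.Prime := Fact.out
  -- modularity: the newform `f_E`, `a_ℓ(f_E) = a_ℓ(E)`, `p ∤ N`, `a_p(f_E)` a `p`-adic unit
  obtain ⟨f, hf⟩ := hmod W
  have hpN : ¬ p ∣ W.conductorNorm ℤ := not_dvd_level_of_isNewformOf hf hgood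
  have hfℓ : ∀ (ℓ : ℕ) [Fact ℓ.Prime], W.HasGoodReductionAtPrime ℓ →
      (qExpansion 1 ⇑f).coeff ℓ = (W.frobeniusTrace ℓ : ℂ) := by
    intro ℓ _ hℓ
    rw [← WeierstrassCurve.LFunction_apply_prime_eq_frobeniusTrace W ℓ hℓ]
    exact hf.2 ℓ
  obtain ⟨ι₀⟩ := PadicAlgCl.nonempty_ringEquiv_complex p
  have hιf : ∀ (ℓ : ℕ) [Fact ℓ.Prime], W.HasGoodReductionAtPrime ℓ →
      ι₀.symm ((qExpansion 1 ⇑f).coeff ℓ) = ((W.frobeniusTrace ℓ : ℤ) : PadicAlgCl p) := by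
    intro ℓ _ hℓ
    rw [hfℓ ℓ hℓ, map_intCast]
  have hordf : ‖ι₀.symm ((qExpansion 1 ⇑f).coeff p)‖ = 1 := by
    rw [hιf p hgood]
    exact DeligneSerreLift.norm_intCast_eq_one_of_not_dvd hord
  -- the `Λ`-adic step (hypothesis): the weight-`k` member of the family through `f_E`
  obtain ⟨F, b, u, hF0, hT, hU, hu, hnew, hcong⟩ :=
    hHida p ι₀ (W.conductorNorm ℤ) hp5 hpN 2 le_rfl f hf.1 hordf k (by omega) hpk
  -- the classical descent to level `N`
  obtain ⟨g, hgnew, hga, -, hnorm⟩ :=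
    exists_isNewform0_level_of_ordinary_pStabilised_of_new ι₀ hpN hk hF0 hT hU hu hnew
  let ι : coeffField g →+* PadicAlgCl p :=
    (ι₀.symm : ℂ →+* PadicAlgCl p).comp (algebraMap (coeffField g) ℂ)
  have hι : ∀ (x : ℂ) (hx : x ∈ coeffField g), ι ⟨x, hx⟩ = ι₀.symm x := fun _ _ ↦ rfl
  refine ⟨g, ι, hgnew, by rw [hι]; exact hnorm, fun ℓ hℓ hℓNp ↦ ?_⟩
  have hℓN : ¬ ℓ ∣ W.conductorNorm ℤ := fun h' ↦ hℓNp (h'.mul_right p)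
  haveI : Fact ℓ.Prime := ⟨hℓ⟩
  have hgoodℓ : W.HasGoodReductionAtPrime ℓ := hasGoodReductionAtPrime_of_not_dvd_conductorNorm W hℓN
  rw [hι, hga ℓ hℓ hℓNp, ← hιf ℓ hgoodℓ]
  exact hcong ℓ hℓ hℓNp

end Literature.NumberTheory.EllipticCurves

end
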